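import Literature.NumberTheory.CubicFields.VoronoiReduction
import Literature.NumberTheory.CubicFields.CubicRegulatorBound
import Mathlib.Analysis.SpecialFunctions.Log.Basic
import Mathlib.Analysis.Complex.ExponentialBounds
import Mathlib.Data.Nat.Size
import Literature.Computability.Cryptography.CubicClassTableSemWalk
import Literature.Computability.Cryptography.CubicClassTableSemBE
import Literature.NumberTheory.NumberFields.PureCubicDiscriminantBound
import Literature.NumberTheory.CubicFields.VoronoiCylinderStep
import Literature.NumberTheory.CubicFields.PeriodicChainCells
import Literature.NumberTheory.CubicFields.PureCubicLatticeSemantics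
import Literature.NumberTheory.NumberFields.PureCubicOrder
import Literature.Computability.Cryptography.CubicClassTableSemPow
import Literature.NumberTheory.CubicFields.PeriodicChainCellsGrid
import HarnessLib

/-!
# The pure-cubic class-group table semantics, I: regulator/period numerics, walk package, per-position semantics, packing (re-homed proofs)

**The semantics claim `ClaimTableSem` of the pure-cubic class-group table HOLDS — file 1 of 2 (supporting packages)** — the named fact
`Literature.Computability.Cryptography.CubicClassSampling.ClaimTableSem` (`CubicClassSamplingSpecs.lean`; the class-group table of a
pure cubic field read as a shift-cell / coset table over the Voronoi chain of the reduced-ideal cycle: Buchmann–Williams, Math. Comp. 50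
(1988), §3 [BuchmannWilliams1988]; Hallgren, STOC 2005, §4 [Hallgren2005]), EXACT name
`Literature.Computability.Cryptography.CubicClassSampling.ClaimTableSem_holds`.  The proof is the assembly of the tree's Literature layer
`Literature/Computability/Cryptography/CubicClassTableSem{Step,Pow,BE,Ladder,Descend,Walk}.lean`, `CubicClassTable{Specs,Coins,ProgramSpecs}.lean`
and `Literature/NumberTheory/CubicFields/*` (Voronoi reduction / relative minima / chains, periodic chain cells, pure cubic lattice
semantics, relation lattices, regulator bounds) with the 81 remaining theorems of the Summits side: the regulator/period bookkeeping, the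
class-table numerics, the walk package, the per-position semantics (cells, coordinates, drift, core, circle, affine charts), packing,
the filtered Voronoi cycle, the relation-lattice index, classes/cells/coins/index/slots packages, the reduced giant-step cycle, and the
final assembly `ClaimTableSem_holds`.
RE-HOMED into `Literature/` by the Hodge foundations lane (`lit-hodgefound`, seat p20, generation 40): verbatim DECLARATION-LEVEL ports (the
declarations needed, in dependency order) of 24 theorem-only modules `Summits/QuantumAdvantage/QuantumAdvantage/Theorems/LinnikCubicClassGroupsPureCubicClassGroupFBQP{Stub*,∅}.lean`,
namespace `Summit.QuantumAdvantage.QuantumAdvantage.Theorems.LinnikCubicClassGroups` re-rooted as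
`Literature.Computability.Cryptography.CubicClassSampling.LinnikStubs` (the convention of `CubicClassSamplingClaimsHold.lean`; the in-tree theorem
names are kept so that twins have the same short names).  Theorem-only file: no definition, no new named fact (D-0026); imports
Mathlib/Literature only; every declaration carries the citation of the printed statement it formalises or serves.  The Summits originals
stay in place (transitional duplication).  WHAT THIS IS NOT: nothing here bears on `BQP ⊄ BPP` or any quantum-advantage statement; it is
the classical number-theoretic semantics of the class-group table of a pure cubic field.
-/

noncomputable section

/-!
## Part 1 — port of `Summits/QuantumAdvantage/QuantumAdvantage/Theorems/LinnikCubicClassGroupsPureCubicClassGroupFBQPStubRegulatorPeriod.lean` (5 declarations kept)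

# `LinnikCubicClassGroups.PureCubicClassGroupFBQP` () — stub `stub_regulatorPeriod`

Declarations of this Part (verbatim port; each keeps its own docstring and citation): `exists_isReal_place_eq_abs`, `exists_isComplex_place`, `exists_unit_regulator_eq_abs_log`, `exists_one_lt_log_eq_regulator`, `stub_regulatorPeriod`.
-/

section Part1

namespace Literature.Computability.Cryptography.CubicClassSampling.LinnikStubs

open scoped _root_.NumberField
open _root_.NumberField _root_.NumberField.InfinitePlace NumberField.Units

/-- A real embedding `σ : K →+* ℝ` defines a real infinite place, `x ↦ |σ x|`.
[cite: BuchmannWilliams1988, §3 (semantics of the class-group table; supporting lemma)] -/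
theorem exists_isReal_place_eq_abs {K : Type} [Field K] (σ : K →+* ℝ) :
    ∃ w : InfinitePlace K, w.IsReal ∧ ∀ x : K, w x = |σ x| := by
  refine ⟨InfinitePlace.mk ((algebraMap ℝ ℂ).comp σ), isReal_mk_iff.mpr ?_, fun x => ?_⟩
  · rw [ComplexEmbedding.isReal_iff]
    exact RingHom.ext fun x => by simp [ComplexEmbedding.conjugate_coe_eq, Complex.conj_ofReal]
  · rw [InfinitePlace.apply]
    simp [Complex.norm_real]

/-- A non-real embedding `σ : K →+* ℂ` defines a complex infinite place.
[cite: BuchmannWilliams1988, §3 (semantics of the class-group table; supporting lemma)] -/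
theorem exists_isComplex_place {K : Type} [Field K] (σ : K →+* ℂ)
    (h : ∃ z : K, starRingEnd ℂ (σ z) ≠ σ z) : ∃ w : InfinitePlace K, w.IsComplex := by
  obtain ⟨z, hz⟩ := h
  refine ⟨InfinitePlace.mk σ, isComplex_mk_iff.mpr fun hreal => hz ?_⟩
  rw [ComplexEmbedding.isReal_iff] at hreal
  simpa only [ComplexEmbedding.conjugate_coe_eq] using RingHom.congr_fun hreal z

/-- **Dirichlet for signature `(1, 1)`.** In a cubic number field with a real embedding `σ₁` and a
non-real embedding `σ₂` there is a unit `g` (a fundamental unit) with `regulator K = |log |σ₁ g||`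
such that `|σ₁ u|` is an integer power of `|σ₁ g|` for every unit `u`.
[cite: BuchmannWilliams1988, §3 (semantics of the class-group table; supporting lemma)] -/
theorem exists_unit_regulator_eq_abs_log {K : Type} [Field K] [NumberField K]
    (h3 : Module.finrank ℚ K = 3) (σ₁ : K →+* ℝ) (σ₂ : K →+* ℂ)
    (hσ₂ : ∃ z : K, starRingEnd ℂ (σ₂ z) ≠ σ₂ z) :
    ∃ g : (𝓞 K)ˣ, regulator K = abs (Real.log |σ₁ (g : K)|) ∧
      ∀ u : (𝓞 K)ˣ, ∃ n : ℤ, |σ₁ (u : K)| = |σ₁ (g : K)| ^ n := by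
  classical
  obtain ⟨w₁, hw₁, hw₁app⟩ := exists_isReal_place_eq_abs σ₁
  obtain ⟨w₂, hw₂⟩ := exists_isComplex_place σ₂ hσ₂
  -- signature `(1, 1)`
  have hsig : nrRealPlaces K = 1 ∧ nrComplexPlaces K = 1 := by
    have h := card_add_two_mul_card_eq_rank K
    rw [h3] at h
    have hc : 0 < nrComplexPlaces K := Fintype.card_pos_iff.mpr ⟨⟨w₂, hw₂⟩⟩
    omega
  -- every place other than `w₂` is `w₁`
  have hplace : ∀ w : InfinitePlace K, w ≠ w₂ → w = w₁ := by
    intro w hw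
    rcases isReal_or_isComplex w with h | h
    · haveI := Fintype.card_le_one_iff_subsingleton.mp hsig.1.le
      exact congrArg Subtype.val (Subsingleton.elim (⟨w, h⟩ : {w // IsReal w}) ⟨w₁, hw₁⟩)
    · haveI := Fintype.card_le_one_iff_subsingleton.mp hsig.2.le
      exact absurd (congrArg Subtype.val
        (Subsingleton.elim (⟨w, h⟩ : {w // IsComplex w}) ⟨w₂, hw₂⟩)) hw
  haveI : Subsingleton {w : InfinitePlace K // w ≠ w₂} :=
    ⟨fun a b => Subtype.ext ((hplace a.1 a.2).trans (hplace b.1 b.2).symm)⟩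
  let w₁' : {w : InfinitePlace K // w ≠ w₂} := ⟨w₁, ne_of_isReal_isComplex hw₁ hw₂⟩
  have hrank : rank K = 1 := by
    rw [rank, card_eq_nrRealPlaces_add_nrComplexPlaces, hsig.1, hsig.2]
  haveI : Subsingleton (Fin (rank K)) := by rw [hrank]; infer_instance
  have hc : Fintype.card {w : InfinitePlace K // w ≠ w₂} = Fintype.card (Fin (rank K)) := by
    rw [Fintype.card_fin, hrank, Fintype.card_eq_one_iff]
    exact ⟨w₁', fun _ => Subsingleton.elim _ _⟩
  obtain ⟨e⟩ : Nonempty ({w : InfinitePlace K // w ≠ w₂} ≃ Fin (rank K)) :=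
    ⟨Fintype.equivOfCardEq hc⟩
  refine ⟨fundSystem K (e w₁'), ?_, fun u => ?_⟩
  · -- the `1 × 1` regulator determinant at the real place
    have hmult : mult w₁'.val = 1 := mult_isReal ⟨w₁, hw₁⟩
    have hval : ∀ x : K, w₁'.val x = |σ₁ x| := hw₁app
    rw [regulator_eq_det K w₂ e, Matrix.det_eq_elem_of_subsingleton _ w₁', Matrix.of_apply, hmult,
      Nat.cast_one, one_mul, hval]
  · -- every unit is `ζ g^n`, `ζ` torsion, and `|σ₁ ζ| = w₁ ζ = 1`
    obtain ⟨ζe, hu, -⟩ := exist_unique_eq_mul_prod K u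
    refine ⟨ζe.2 (e w₁'), ?_⟩
    rw [Fintype.prod_subsingleton _ (e w₁')] at hu
    have hζ : |σ₁ ((ζe.1 : (𝓞 K)ˣ) : K)| = 1 := by
      rw [← hw₁app]
      exact (mem_torsion K).mp ζe.1.2 w₁
    rw [hu, NumberField.Units.coe_mul, NumberField.Units.coe_zpow, map_mul, map_zpow₀, abs_mul,
      abs_zpow, hζ, one_mul]

/-- The normalised generator: a real number `c > 1` with `log c = regulator K`, attained as `σ₁ ε`
for some unit `ε`, such that `|σ₁ u|` is an integer power of `c` for every unit `u`.
[cite: BuchmannWilliams1988, §3 (semantics of the class-group table; supporting lemma)] -/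
theorem exists_one_lt_log_eq_regulator {K : Type} [Field K] [NumberField K]
    (h3 : Module.finrank ℚ K = 3) (σ₁ : K →+* ℝ) (σ₂ : K →+* ℂ)
    (hσ₂ : ∃ z : K, starRingEnd ℂ (σ₂ z) ≠ σ₂ z) :
    ∃ c : ℝ, 1 < c ∧ Real.log c = regulator K ∧ (∃ ε : (𝓞 K)ˣ, σ₁ (ε : K) = c) ∧
      ∀ u : (𝓞 K)ˣ, ∃ n : ℤ, |σ₁ (u : K)| = c ^ n := by
  obtain ⟨g, hreg, hpow⟩ := exists_unit_regulator_eq_abs_log h3 σ₁ σ₂ hσ₂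
  -- adjust the sign: `σ₁ (±g) = |σ₁ g|`
  obtain ⟨g', hg'⟩ : ∃ g' : (𝓞 K)ˣ, σ₁ (g' : K) = |σ₁ (g : K)| := by
    rcases le_or_gt 0 (σ₁ (g : K)) with h | h
    · exact ⟨g, (abs_of_nonneg h).symm⟩
    · exact ⟨-g, by rw [Units.val_neg, map_neg, map_neg, abs_of_neg h]⟩
  set b := |σ₁ (g : K)| with hb
  have hb0 : 0 < b := abs_pos.mpr ((map_ne_zero σ₁).mpr (coe_ne_zero g))
  have hb1 : b ≠ 1 := fun h => regulator_ne_zero K (by rw [hreg, h, Real.log_one, abs_zero])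
  rcases hb1.lt_or_gt with hlt | hgt
  · -- `b < 1`: take `c = b⁻¹ = σ₁ (g'⁻¹)`
    refine ⟨b⁻¹, (one_lt_inv₀ hb0).mpr hlt, ?_, ⟨g'⁻¹, ?_⟩, fun u => ?_⟩
    · rw [Real.log_inv, hreg, abs_of_neg (Real.log_neg hb0 hlt)]
    · rw [map_units_inv, map_inv₀, hg']
    · obtain ⟨n, hn⟩ := hpow u
      exact ⟨-n, by rw [hn, inv_zpow', neg_neg]⟩
  · -- `1 < b`: take `c = b = σ₁ g'`
    exact ⟨b, hgt, by rw [hreg, abs_of_pos (Real.log_pos hgt)], ⟨g', hg'⟩, hpow⟩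

/-- **S2 `stub_regulatorPeriod`** (Dirichlet for signature `(1, 1)`). A cubic number field `K` with a
real embedding `σ₁` and a NON-REAL embedding `σ₂` has a unit `ε` of `𝓞 K` with `σ₁ ε > 1` which is
LEAST with this property, and `log σ₁(ε)` is Mathlib's regulator of `K` — the period of the distance
function `log |σ₁ ·|` along the cycle of reduced divisors.
[cite: BuchmannWilliams1988, §3 (semantics of the class-group table; supporting lemma)] -/
theorem stub_regulatorPeriod : ∀ (K : Type) [Field K] [NumberField K], Module.finrank ℚ K = 3 →
    ∀ (σ₁ : K →+* ℝ) (σ₂ : K →+* ℂ), (∃ z : K, starRingEnd ℂ (σ₂ z) ≠ σ₂ z) →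
    ∃ ε : (𝓞 K)ˣ, 1 < σ₁ ((ε : 𝓞 K) : K) ∧
      Real.log (σ₁ ((ε : 𝓞 K) : K)) = NumberField.Units.regulator K ∧
      ∀ u : (𝓞 K)ˣ, 1 < σ₁ ((u : 𝓞 K) : K) → σ₁ ((ε : 𝓞 K) : K) ≤ σ₁ ((u : 𝓞 K) : K) := by
  intro K _ _ h3 σ₁ σ₂ hσ₂
  obtain ⟨c, hc1, hreg, ⟨ε, hε⟩, hpow⟩ := exists_one_lt_log_eq_regulator h3 σ₁ σ₂ hσ₂
  refine ⟨ε, ?_, ?_, fun u hu => ?_⟩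
  · rw [NumberField.Units.coe_coe, hε]
    exact hc1
  · rw [NumberField.Units.coe_coe, hε, hreg]
  · rw [NumberField.Units.coe_coe] at hu
    rw [NumberField.Units.coe_coe, NumberField.Units.coe_coe, hε]
    obtain ⟨n, hn⟩ := hpow u
    rw [abs_of_pos (one_pos.trans hu)] at hn
    rw [hn] at hu ⊢
    have hn1 : 1 ≤ n := by have := (one_lt_zpow_iff_right₀ hc1).mp hu; omega
    calc c = c ^ (1 : ℤ) := (zpow_one c).symm
      _ ≤ c ^ n := zpow_le_zpow_right₀ hc1.le hn1

end Literature.Computability.Cryptography.CubicClassSampling.LinnikStubs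

end Part1

/-!
## Part 2 — port of `Summits/QuantumAdvantage/QuantumAdvantage/Theorems/LinnikCubicClassGroupsPureCubicClassGroupFBQPStubCubicFieldFacts.lean` (2 declarations kept)

# `LinnikCubicClassGroups.PureCubicClassGroupFBQP` () — stub `stub_cubicFieldFacts`

Declarations of this Part (verbatim port; each keeps its own docstring and citation): `facts_ideals_of_norm`, `facts_ideals_le`.
-/

section Part2

namespace Literature.Computability.Cryptography.CubicClassSampling.LinnikStubs

open scoped _root_.NumberField nonZeroDivisors
open _root_.Polynomial

section discr

variable {K : Type*} [Field K] [NumberField K]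

end discr

section classNumber

variable {K : Type*} [Field K] [NumberField K]

/-- In a cubic field, the ideals of `𝓞 K` of norm `n ≥ 1` number at most `n ^ 9`: such an ideal `I`
contains `n`, so it is the preimage of the ideal of `𝓞 K ⧸ (n)` (a ring with `n³` elements)
spanned by the images of a `ℤ`-basis of `I`, which has `3` elements.
[cite: BuchmannWilliams1988, §3 (semantics of the class-group table; supporting lemma)] -/
theorem facts_ideals_of_norm (hdeg : Module.finrank ℚ K = 3) {n : ℕ} (hn : n ≠ 0) :
    {I : Ideal (𝓞 K) | Ideal.absNorm I = n}.ncard ≤ n ^ 9 := by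
  classical
  have hι : Fintype.card (Module.Free.ChooseBasisIndex ℤ (𝓞 K)) = 3 := by
    rw [← Module.finrank_eq_card_chooseBasisIndex, NumberField.RingOfIntegers.rank, hdeg]
  have hcard : Nat.card (𝓞 K ⧸ Ideal.span {(n : 𝓞 K)}) = n ^ 3 := by
    rw [← Submodule.cardQuot_apply, ← Ideal.absNorm_apply, Ideal.absNorm_span_singleton,
      ← map_natCast (algebraMap ℤ (𝓞 K)), Algebra.norm_algebraMap,
      NumberField.RingOfIntegers.rank, hdeg, Int.natAbs_pow, Int.natAbs_natCast]
  haveI : Finite (𝓞 K ⧸ Ideal.span {(n : 𝓞 K)}) :=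
    Nat.finite_of_card_ne_zero (by rw [hcard]; positivity)
  set q := Ideal.Quotient.mk (Ideal.span {(n : 𝓞 K)})
  let G : (Module.Free.ChooseBasisIndex ℤ (𝓞 K) → 𝓞 K ⧸ Ideal.span {(n : 𝓞 K)}) →
      Ideal (𝓞 K) := fun g => Ideal.comap q (Ideal.span (Set.range g))
  have hsub : {I : Ideal (𝓞 K) | Ideal.absNorm I = n} ⊆ Set.range G := by
    intro I hI
    rw [Set.mem_setOf_eq] at hI
    have hI0 : I ≠ ⊥ := by
      rintro rfl
      rw [Ideal.absNorm_bot] at hI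
      exact hn hI.symm
    have hle : Ideal.span {(n : 𝓞 K)} ≤ I := hI ▸ Ideal.span_singleton_absNorm_le I
    let b := Ideal.selfBasis (NumberField.RingOfIntegers.basis K) I hI0
    refine ⟨fun i => q (b i), ?_⟩
    show Ideal.comap q (Ideal.span (Set.range fun i => q (b i))) = I
    conv_rhs => rw [← Ideal.comap_map_mk hle]
    congr 1
    apply le_antisymm
    · rw [Ideal.span_le]
      rintro _ ⟨i, rfl⟩
      exact Ideal.mem_map_of_mem q (b i).2
    · rw [Ideal.map_le_iff_le_comap]
      intro x hx
      have hx' := congr_arg (fun y : I => q (y : 𝓞 K)) (b.sum_repr ⟨x, hx⟩)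
      simp only [Submodule.coe_sum, Submodule.coe_smul_of_tower, map_sum, map_zsmul] at hx'
      rw [Ideal.mem_comap, ← hx']
      exact Ideal.sum_mem _ fun i _ => zsmul_mem (Ideal.subset_span (Set.mem_range_self i)) _
  calc {I : Ideal (𝓞 K) | Ideal.absNorm I = n}.ncard
      ≤ (Set.range G).ncard := Set.ncard_le_ncard hsub (Set.finite_range G)
    _ ≤ Nat.card (Module.Free.ChooseBasisIndex ℤ (𝓞 K) → 𝓞 K ⧸ Ideal.span {(n : 𝓞 K)}) := by
        rw [← Set.image_univ, ← Set.ncard_univ]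
        exact Set.ncard_image_le Set.finite_univ
    _ = n ^ 9 := by
        rw [Nat.card_fun, hcard, Nat.card_eq_fintype_card, hι, ← pow_mul]

/-- Summing the previous count: the ideals of `𝓞 K` of norm in `[1, B]` number at most `B ^ 10`.
[cite: BuchmannWilliams1988, §3 (semantics of the class-group table; supporting lemma)] -/
theorem facts_ideals_le (hdeg : Module.finrank ℚ K = 3) (B : ℕ) :
    {I : Ideal (𝓞 K) | 1 ≤ Ideal.absNorm I ∧ Ideal.absNorm I ≤ B}.ncard ≤ B ^ 10 := by
  induction B with
  | zero =>
    rw [show {I : Ideal (𝓞 K) | 1 ≤ Ideal.absNorm I ∧ Ideal.absNorm I ≤ 0} = ∅ from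
      Set.eq_empty_of_forall_notMem fun I hI => by simp only [Set.mem_setOf_eq] at hI; omega]
    simp
  | succ B ih =>
    have hsplit : {I : Ideal (𝓞 K) | 1 ≤ Ideal.absNorm I ∧ Ideal.absNorm I ≤ B + 1} ⊆
        {I | 1 ≤ Ideal.absNorm I ∧ Ideal.absNorm I ≤ B} ∪ {I | Ideal.absNorm I = B + 1} := by
      rintro I ⟨h1, h2⟩
      rcases Nat.lt_or_ge (Ideal.absNorm I) (B + 1) with h | h
      · exact Or.inl ⟨h1, Nat.lt_succ_iff.mp h⟩
      · exact Or.inr (le_antisymm h2 h)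
    have hfin : ({I : Ideal (𝓞 K) | 1 ≤ Ideal.absNorm I ∧ Ideal.absNorm I ≤ B} ∪
        {I | Ideal.absNorm I = B + 1}).Finite :=
      ((Ideal.finite_setOf_absNorm_le B).subset fun I hI => hI.2).union
        (Ideal.finite_setOf_absNorm_eq _)
    calc _ ≤ _ := Set.ncard_le_ncard hsplit hfin
      _ ≤ _ := Set.ncard_union_le _ _
      _ ≤ B ^ 10 + (B + 1) ^ 9 := add_le_add ih (facts_ideals_of_norm hdeg B.succ_ne_zero)
      _ = B ^ 9 * B + (B + 1) ^ 9 := by ring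
      _ ≤ (B + 1) ^ 9 * B + (B + 1) ^ 9 := by gcongr; exact B.le_succ
      _ = (B + 1) ^ 10 := by ring

end classNumber

end Literature.Computability.Cryptography.CubicClassSampling.LinnikStubs

end Part2

/-!
## Part 3 — port of `Summits/QuantumAdvantage/QuantumAdvantage/Theorems/LinnikCubicClassGroupsPureCubicClassGroupFBQPStubCubicReduction.lean` (1 declarations kept)

# `LinnikCubicClassGroups.PureCubicClassGroupFBQP` () — stub `stub_cubicReduction`

Declarations of this Part (verbatim port; each keeps its own docstring and citation): `regulator_le_abs_discr_pow_six`.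
-/

section Part3

namespace Literature.Computability.Cryptography.CubicClassSampling.LinnikStubs

open scoped _root_.NumberField nonZeroDivisors
open _root_.NumberField
open Literature.NumberTheory.CubicFields

/-- **Conjunct (4): `R_K ≤ |d_K|⁶`** for a cubic field `K` with a real embedding `σ₁` and a non-real
embedding `σ₂`: `R_K = log σ₁ ε ≤ #{integral ideals of norm ≤ 2√|d_K|/π} · log (3√|d_K|)
≤ (2/3)^10 |d_K|^5 · 3 |d_K| ≤ |d_K|^6`.
[cite: BuchmannWilliams1988, §3 (semantics of the class-group table; supporting lemma)] -/
theorem regulator_le_abs_discr_pow_six (K : Type) [Field K] [NumberField K] (hdeg : Module.finrank ℚ K = 3)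
    (σ₁ : K →+* ℝ) (σ₂ : K →+* ℂ) (hσ₂ : ∃ z : K, starRingEnd ℂ (σ₂ z) ≠ σ₂ z) :
    Units.regulator K ≤ |(discr K : ℝ)| ^ 6 := by
  obtain ⟨ε, hε, hreg, hmin⟩ := stub_regulatorPeriod K hdeg σ₁ σ₂ hσ₂
  rw [← hreg]
  set d : ℝ := |(discr K : ℝ)| with hd
  have hnorm : ∀ θ ∈ posRelMinima σ₁ σ₂ (1 : FractionalIdeal (𝓞 K)⁰ K),
      |σ₁ θ| * ‖σ₂ θ‖ ^ 2 ≤ 2 * Real.sqrt d / Real.pi := fun θ hθ => by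
    have h := abs_mul_norm_sq_le_of_mem_relMinima hdeg hσ₂ hθ.1
    rwa [FractionalIdeal.absNorm_one, Rat.cast_one, mul_one] at h
  have h := log_unit_le_ncard_mul_log hdeg hσ₂ ε hε hmin (one_mem_posRelMinima_one hdeg hσ₂)
    (G := 3 * Real.sqrt d) (M := 2 * Real.sqrt d / Real.pi) ?_
    (fun μ hμ => voronoiSucc_le_mul hdeg hσ₂ ε hε hμ) hnorm
  swap
  · rw [hd, ← mul_one (1 : ℝ)]
    refine mul_le_mul (by norm_num) ?_ zero_le_one (by norm_num)
    rw [Real.one_le_sqrt, ← Int.cast_abs]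
    exact_mod_cast (abs_discr_gt_two (K := K) (by rw [hdeg]; norm_num)).le.trans' (by norm_num)
  have hd2 : 2 < d := by
    have h2 := abs_discr_gt_two (K := K) (by rw [hdeg]; norm_num)
    rw [hd, ← Int.cast_abs]; exact_mod_cast h2
  have hsq : Real.sqrt d ^ 2 = d := Real.sq_sqrt (by linarith)
  have hs1 : 1 ≤ Real.sqrt d := by rw [Real.one_le_sqrt]; linarith
  have hcount : ({I : Ideal (𝓞 K) | 1 ≤ Ideal.absNorm I ∧
      Ideal.absNorm I ≤ ⌊2 * Real.sqrt d / Real.pi⌋₊}.ncard : ℝ) ≤ (2 / 3) ^ 10 * d ^ 5 := by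
    have h1 := facts_ideals_le (K := K) hdeg ⌊2 * Real.sqrt d / Real.pi⌋₊
    have h2 : (⌊2 * Real.sqrt d / Real.pi⌋₊ : ℝ) ≤ 2 * Real.sqrt d / 3 := by
      calc (⌊2 * Real.sqrt d / Real.pi⌋₊ : ℝ) ≤ 2 * Real.sqrt d / Real.pi := Nat.floor_le (by positivity)
        _ ≤ 2 * Real.sqrt d / 3 := by gcongr; exact Real.pi_gt_three.le
    calc ({I : Ideal (𝓞 K) | 1 ≤ Ideal.absNorm I ∧ Ideal.absNorm I ≤ ⌊2 * Real.sqrt d / Real.pi⌋₊}.ncard : ℝ)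
        ≤ ((⌊2 * Real.sqrt d / Real.pi⌋₊ ^ 10 : ℕ) : ℝ) := by exact_mod_cast h1
      _ = (⌊2 * Real.sqrt d / Real.pi⌋₊ : ℝ) ^ 10 := by push_cast; ring
      _ ≤ (2 * Real.sqrt d / 3) ^ 10 := pow_le_pow_left₀ (by positivity) h2 10
      _ = (2 / 3) ^ 10 * (Real.sqrt d ^ 2) ^ 5 := by ring
      _ = (2 / 3) ^ 10 * d ^ 5 := by rw [hsq]
  have hlog : Real.log (3 * Real.sqrt d) ≤ 3 * d := by
    have h1 := Real.log_le_sub_one_of_pos (show 0 < 3 * Real.sqrt d by positivity)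
    have h2 : Real.sqrt d ≤ d := by nlinarith
    linarith
  have hlog0 : 0 ≤ Real.log (3 * Real.sqrt d) := Real.log_nonneg (by linarith)
  have hd0 : 0 < d := by linarith
  calc Real.log (σ₁ ((ε : 𝓞 K) : K))
      ≤ ({I : Ideal (𝓞 K) | 1 ≤ Ideal.absNorm I ∧ Ideal.absNorm I ≤ ⌊2 * Real.sqrt d / Real.pi⌋₊}.ncard : ℝ) *
          Real.log (3 * Real.sqrt d) := h
    _ ≤ (2 / 3) ^ 10 * d ^ 5 * (3 * d) := mul_le_mul hcount hlog hlog0 (by positivity)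
    _ = (3 * (2 / 3) ^ 10) * d ^ 6 := by ring
    _ ≤ 1 * d ^ 6 := by gcongr; norm_num
    _ = d ^ 6 := one_mul _

end Literature.Computability.Cryptography.CubicClassSampling.LinnikStubs

end Part3

/-!
## Part 4 — port of `Summits/QuantumAdvantage/QuantumAdvantage/Theorems/LinnikCubicClassGroupsPureCubicClassGroupFBQPStubClassTableSemNumerics.lean` (6 declarations kept)

# `LinnikCubicClassGroups.PureCubicClassGroupFBQP` () — stub `stub_classTableSem`, part NUMERICS

Declarations of this Part (verbatim port; each keeps its own docstring and citation): `num_two_pow_ge`, `num_hbase_lower`, `num_div_six`, `num_baby_budget`, `num_nmax`, `num_levels`.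
-/

section Part4

namespace Literature.Computability.Cryptography.CubicClassSampling.LinnikStubs

/-- `2^9 ≤ 2^prec` for `prec ≥ 9`, read in `ℝ`.
[cite: BuchmannWilliams1988, §3 (semantics of the class-group table; supporting lemma)] -/
theorem num_two_pow_ge {prec : ℕ} (hprec : 9 ≤ prec) : (512 : ℝ) ≤ 2 ^ prec := by
  calc (512 : ℝ) = 2 ^ 9 := by norm_num
    _ ≤ 2 ^ prec := pow_le_pow_right₀ (by norm_num) hprec

/-- **The ladder base is far enough**: `2 KInt ≤ p₀`.
[cite: BuchmannWilliams1988, §3 (semantics of the class-group table; supporting lemma)] -/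
theorem num_hbase_lower {prec KN : ℕ} {p₀ G : ℝ} (hprec : 9 ≤ prec) (hKN : 1 ≤ KN)
    (herr : |p₀ - 2 ^ prec * G| ≤ ((18 * KN : ℕ) : ℝ)) (hG : ((18 * KN / 6 : ℕ) : ℝ) * Real.log 2 ≤ G) :
    2 * ((2 ^ prec * KN : ℕ) : ℝ) ≤ p₀ := by
  have h2p := num_two_pow_ge hprec
  have hdiv : (18 * KN / 6 : ℕ) = 3 * KN := by omega
  rw [hdiv] at hG
  have hl2 := Real.log_two_gt_d9
  rw [abs_le] at herr
  push_cast at herr hG ⊢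
  have hKN' : (1 : ℝ) ≤ KN := by exact_mod_cast hKN
  have h1 : (2 : ℝ) ^ prec * (3 * KN * 0.6931471803) ≤ 2 ^ prec * G := by
    apply mul_le_mul_of_nonneg_left _ (by positivity); nlinarith
  nlinarith [mul_le_mul_of_nonneg_right h2p (by positivity : (0 : ℝ) ≤ KN)]

/-- `6 ⌊n/6⌋ ≥ n − 5`, read in `ℝ`.
[cite: BuchmannWilliams1988, §3 (semantics of the class-group table; supporting lemma)] -/
theorem num_div_six (n : ℕ) : (n : ℝ) - 5 ≤ 6 * ((n / 6 : ℕ) : ℝ) := by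
  have h := Nat.div_add_mod n 6
  have h2 : n % 6 < 6 := Nat.mod_lt _ (by norm_num)
  have : (n : ℝ) = 6 * ((n / 6 : ℕ) : ℝ) + ((n % 6 : ℕ) : ℝ) := by exact_mod_cast h.symm
  have h3 : ((n % 6 : ℕ) : ℝ) ≤ 5 := by exact_mod_cast Nat.lt_succ_iff.mp h2
  linarith

/-- **The baby-step budget**: the residual after the descent is out-advanced by `Bb ≥ 32 KN²` six-gapped steps.
[cite: BuchmannWilliams1988, §3 (semantics of the class-group table; supporting lemma)] -/
theorem num_baby_budget {prec KN Bb : ℕ} {LB C : ℝ} (hprec : 9 ≤ prec) (hKN48 : 48 ≤ KN) (hLB : 11 * LB + 1 ≤ KN)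
    (hLB0 : 0 ≤ LB) (hBb : 32 * KN ^ 2 ≤ Bb) (hC : C ≤ 2 ^ prec * (18 * KN * LB + KN) + 18 * KN) :
    C < 2 ^ prec * ((Bb / 6 : ℕ) : ℝ) * Real.log 2 - Bb := by
  have h2p := num_two_pow_ge hprec
  have hl2 := Real.log_two_gt_d9
  have hl2' := Real.log_two_lt_d9
  have hKN' : (48 : ℝ) ≤ KN := by exact_mod_cast hKN48
  have hBb' : (32 : ℝ) * (KN : ℝ) ^ 2 ≤ Bb := by exact_mod_cast hBb
  have hd6 := num_div_six Bb
  -- lower bound for the right-hand side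
  have hR : ((Bb : ℝ) - 5) / 6 * (2 ^ prec * Real.log 2) - Bb ≤ 2 ^ prec * ((Bb / 6 : ℕ) : ℝ) * Real.log 2 - Bb := by
    have : ((Bb : ℝ) - 5) / 6 ≤ ((Bb / 6 : ℕ) : ℝ) := by linarith
    nlinarith [mul_le_mul_of_nonneg_right this (by positivity : (0 : ℝ) ≤ 2 ^ prec * Real.log 2)]
  -- the coefficient of `Bb` is positive
  have hcoef : (58 : ℝ) ≤ 2 ^ prec * Real.log 2 / 6 - 1 := by
    rw [le_sub_iff_add_le, le_div_iff₀ (by norm_num)]; nlinarith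
  have hLB' : LB ≤ (KN - 1) / 11 := by rw [le_div_iff₀ (by norm_num)]; linarith
  have hL : C ≤ 2 ^ prec * (18 * KN * ((KN - 1) / 11) + KN) + 18 * KN := by
    refine hC.trans ?_
    have : 18 * (KN : ℝ) * LB ≤ 18 * KN * ((KN - 1) / 11) := by nlinarith
    nlinarith
  have key : 2 ^ prec * (18 * (KN : ℝ) * ((KN - 1) / 11) + KN) + 18 * KN <
      ((Bb : ℝ) - 5) / 6 * (2 ^ prec * Real.log 2) - Bb := by
    -- `Bb (c) - (5/6) 2^prec log 2` with `Bb ≥ 32 KN²`, `c ≥ 58`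
    have e : ((Bb : ℝ) - 5) / 6 * (2 ^ prec * Real.log 2) - Bb =
        Bb * (2 ^ prec * Real.log 2 / 6 - 1) - 5 / 6 * (2 ^ prec * Real.log 2) := by ring
    rw [e]
    have h1 : (32 : ℝ) * KN ^ 2 * (2 ^ prec * Real.log 2 / 6 - 1) ≤ Bb * (2 ^ prec * Real.log 2 / 6 - 1) :=
      mul_le_mul_of_nonneg_right hBb' (by linarith)
    have h2 : (2 : ℝ) ^ prec * (18 * KN * ((KN - 1) / 11) + KN) ≤ 2 ^ prec * (1.7 * KN ^ 2) := by
      apply mul_le_mul_of_nonneg_left _ (by positivity); nlinarith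
    have h3 : (32 : ℝ) * KN ^ 2 * (2 ^ prec * Real.log 2 / 6 - 1) ≥ 32 * KN ^ 2 * (2 ^ prec * 0.115) - 32 * KN ^ 2 := by
      nlinarith [mul_le_mul_of_nonneg_left hl2.le (by positivity : (0 : ℝ) ≤ 2 ^ prec * KN ^ 2)]
    nlinarith [mul_le_mul_of_nonneg_right h2p (by positivity : (0 : ℝ) ≤ KN ^ 2),
      mul_le_mul_of_nonneg_right h2p (by positivity : (0 : ℝ) ≤ KN)]
  linarith

/-- **The number of fired baby steps is at most `20 KN²`.**
[cite: BuchmannWilliams1988, §3 (semantics of the class-group table; supporting lemma)] -/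
theorem num_nmax {prec KN n : ℕ} {LB C : ℝ} (hprec : 9 ≤ prec) (hKN48 : 48 ≤ KN) (hLB : 11 * LB + 1 ≤ KN)
    (hLB0 : 0 ≤ LB) (hC : C ≤ 2 ^ prec * (18 * KN * LB + KN) + 18 * KN)
    (hn : 2 ^ prec * ((n / 6 : ℕ) : ℝ) * Real.log 2 - n ≤ C) : (n : ℝ) ≤ 20 * (KN : ℝ) ^ 2 := by
  have h2p := num_two_pow_ge hprec
  have hl2 := Real.log_two_gt_d9
  have hl2' := Real.log_two_lt_d9
  have hKN' : (48 : ℝ) ≤ KN := by exact_mod_cast hKN48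
  have hd6 := num_div_six n
  have hLB' : LB ≤ (KN - 1) / 11 := by rw [le_div_iff₀ (by norm_num)]; linarith
  have hL : C ≤ 2 ^ prec * (1.7 * (KN : ℝ) ^ 2) + 18 * KN := by
    refine hC.trans ?_
    have : 18 * (KN : ℝ) * LB ≤ 18 * KN * ((KN - 1) / 11) := by nlinarith
    have h2 : (2 : ℝ) ^ prec * (18 * KN * ((KN - 1) / 11) + KN) ≤ 2 ^ prec * (1.7 * KN ^ 2) := by
      apply mul_le_mul_of_nonneg_left _ (by positivity); nlinarith
    nlinarith
  have hn' : ((n : ℝ) - 5) / 6 * (2 ^ prec * Real.log 2) - n ≤ C := by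
    have : ((n : ℝ) - 5) / 6 ≤ ((n / 6 : ℕ) : ℝ) := by linarith
    nlinarith [mul_le_mul_of_nonneg_right this (by positivity : (0 : ℝ) ≤ 2 ^ prec * Real.log 2)]
  by_contra hcon
  push Not at hcon
  have hcoef : (0.115 : ℝ) * 2 ^ prec - 1 ≤ 2 ^ prec * Real.log 2 / 6 - 1 := by
    rw [sub_le_sub_iff_right, le_div_iff₀ (by norm_num)]; nlinarith
  have e : ((n : ℝ) - 5) / 6 * (2 ^ prec * Real.log 2) - n = n * (2 ^ prec * Real.log 2 / 6 - 1) - 5 / 6 * (2 ^ prec * Real.log 2) := by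
    ring
  rw [e] at hn'
  have h1 : (20 : ℝ) * KN ^ 2 * (0.115 * 2 ^ prec - 1) ≤ n * (2 ^ prec * Real.log 2 / 6 - 1) := by
    calc (20 : ℝ) * KN ^ 2 * (0.115 * 2 ^ prec - 1) ≤ 20 * KN ^ 2 * (2 ^ prec * Real.log 2 / 6 - 1) :=
          mul_le_mul_of_nonneg_left hcoef (by positivity)
      _ ≤ n * (2 ^ prec * Real.log 2 / 6 - 1) := mul_le_mul_of_nonneg_right hcon.le (by linarith)
  nlinarith [mul_le_mul_of_nonneg_right h2p (by positivity : (0 : ℝ) ≤ KN ^ 2),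
    mul_le_mul_of_nonneg_right h2p (by positivity : (0 : ℝ) ≤ KN)]

/-- **High ladder levels never fire**: `2 Rint < p_i + KInt` for `i > 6 LD + 9`.
[cite: BuchmannWilliams1988, §3 (semantics of the class-group table; supporting lemma)] -/
theorem num_levels {prec LD i : ℕ} {KInt Rint p d : ℝ} (hpi : (2 ^ i + 1) * KInt ≤ p) (hKInt : 2 ^ prec ≤ KInt)
    (hi : 6 * LD + 9 < i) (hR : 2 * Rint ≤ 2 ^ prec * (2 * d ^ 6 + 2)) (hd0 : 0 ≤ d) (hd : d < 2 ^ LD) :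
    2 * Rint < p + KInt := by
  have hK0 : 0 < KInt := lt_of_lt_of_le (by positivity) hKInt
  have hd6 : d ^ 6 < (2 : ℝ) ^ (6 * LD) := by
    calc d ^ 6 < ((2 : ℝ) ^ LD) ^ 6 := pow_lt_pow_left₀ hd hd0 (by norm_num)
      _ = 2 ^ (6 * LD) := by rw [← pow_mul, mul_comm]
  have h2i : (2 : ℝ) ^ (6 * LD + 10) ≤ 2 ^ i := pow_le_pow_right₀ (by norm_num) hi
  have e : (2 : ℝ) ^ (6 * LD + 10) = 2 ^ (6 * LD) * 1024 := by rw [pow_add]; norm_num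
  have h1 : 2 * (d ^ 6) + 2 < (2 : ℝ) ^ (6 * LD + 10) := by
    rw [e]
    have : (1 : ℝ) ≤ 2 ^ (6 * LD) := one_le_pow₀ (by norm_num)
    nlinarith
  calc 2 * Rint ≤ 2 ^ prec * (2 * d ^ 6 + 2) := hR
    _ < 2 ^ prec * 2 ^ i := mul_lt_mul_of_pos_left (h1.trans_le h2i) (by positivity)
    _ ≤ KInt * 2 ^ i := mul_le_mul_of_nonneg_right hKInt (by positivity)
    _ ≤ p := by nlinarith
    _ < p + KInt := by linarith

end Literature.Computability.Cryptography.CubicClassSampling.LinnikStubs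

end Part4

/-!
## Part 5 — port of `Summits/QuantumAdvantage/QuantumAdvantage/Theorems/LinnikCubicClassGroupsPureCubicClassGroupFBQPStubClassTableSemWalkPkg.lean` (3 declarations kept)

# `LinnikCubicClassGroups.PureCubicClassGroupFBQP` () — stub `stub_classTableSem`, part WALK

Declarations of this Part (verbatim port; each keeps its own docstring and citation): `walk_consts`, `walk_Rint`, `walk_package`.
-/

section Part5

namespace Literature.Computability.Cryptography.CubicClassSampling.LinnikStubs

open scoped _root_.NumberField nonZeroDivisors
open _root_.NumberField
open Literature.NumberTheory.CubicFields
open Literature.NumberTheory.CubicFields.PureCubicCodes (Canon Mem)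
open Literature.NumberTheory.NumberFields.PureCubic (abs_discr_le ne_zero_of_squarefree_mul)
open Literature.Computability.Cryptography
open Literature.Computability.Cryptography.CubicClassTable
open Literature.Computability.Cryptography.CubicClassTable.WalkFns

section Walk

variable {K : Type} [Field K] [NumberField K] {θ : K} {σ₁ : K →+* ℝ} {σ₂ : K →+* ℂ} {F : WalkFns} {I : Inst}
variable (hdeg : Module.finrank ℚ K = 3) (hσ₂ : ∃ z : K, starRingEnd ℂ (σ₂ z) ≠ σ₂ z)
  (ε : (𝓞 K)ˣ) (hε : 1 < σ₁ (algebraMap (𝓞 K) K ε))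
  (hab : Squarefree (I.a * I.b)) (hab1 : I.a * I.b ≠ 1) (hθ : θ ^ 3 = ((I.a * I.b ^ 2 : ℕ) : K))
  (hred : RedSem F I.a I.b K θ σ₁ σ₂) (hprod : ProdSpec I.a I.b K θ F.latProd)
  {cap : ℕ} (hcap : (243 * I.a ^ 2 * I.b ^ 2) ^ 2 ≤ cap) (hprec : 4 * Nat.size (I.a * I.b) + 8 ≤ I.prec)
  (hord : Canon I.ord) (hordm : ∀ φ : K, Mem θ I.b I.ord φ ↔ IsIntegral ℤ φ)
  (h6 : ∀ A : FractionalIdeal (𝓞 K)⁰ K, A ≠ 0 → ∀ x₀ ∈ posRelMinima σ₁ σ₂ A, ∀ i : ℤ,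
    2 * σ₁ (voronoiChain σ₁ σ₂ A x₀ i) ≤ σ₁ (voronoiChain σ₁ σ₂ A x₀ (i + 6)))
  (hR6 : Real.log 2 / 6 ≤ Units.regulator K)
  (hs₀ : I.s₀ = 18 * (10 * Nat.size (I.a * I.b) + 48)) (hTdbl : 6 * Nat.size (27 * I.a ^ 2 * I.b ^ 2) + 16 ≤ I.Tdbl)
  (hBb : 32 * (10 * Nat.size (I.a * I.b) + 48) ^ 2 ≤ I.Bb) (hmargin : I.margin = 0)
  (hr : |(I.r : ℝ) - 2 ^ I.k * Units.regulator K| ≤ 1) (hk4 : 4 ≤ I.k) (hks : I.k + I.s ≤ I.prec)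

include hdeg hab hab1 hθ hprec in
/-- `11 LB + 1 ≤ KN`, `prec ≥ 9`, `|d_K| ≤ 2^prec`, `|d_K| < 2^LD`.
[cite: BuchmannWilliams1988, §3 (semantics of the class-group table; supporting lemma)] -/
theorem walk_consts :
    11 * Real.log (3 * Real.sqrt |(discr K : ℝ)|) + 1 ≤ ((10 * Nat.size (I.a * I.b) + 48 : ℕ) : ℝ) ∧ 9 ≤ I.prec ∧
      |(discr K : ℝ)| < 2 ^ Nat.size (27 * I.a ^ 2 * I.b ^ 2) ∧ 0 < |(discr K : ℝ)| := by
  obtain ⟨ha, hb⟩ := ne_zero_of_squarefree_mul hab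
  have hd0 : 0 < |(discr K : ℝ)| := by rw [← Int.cast_abs]; exact_mod_cast abs_pos.mpr (discr_ne_zero K)
  have hd27 : |(discr K : ℝ)| ≤ 27 * (I.a : ℝ) ^ 2 * (I.b : ℝ) ^ 2 := by
    have h := abs_discr_le hdeg hab hab1 hθ
    rw [← Int.cast_abs]; exact_mod_cast h
  obtain ⟨h9, -, hK, -⟩ := walkParams_bounds ha hb hprec hd0 hd27
  refine ⟨?_, h9, ?_, hd0⟩
  · have h2 : (0 : ℝ) < 2 ^ I.prec := by positivity
    push_cast at hK ⊢
    nlinarith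
  · calc |(discr K : ℝ)| ≤ ((27 * I.a ^ 2 * I.b ^ 2 : ℕ) : ℝ) := by push_cast; exact hd27
      _ < 2 ^ Nat.size (27 * I.a ^ 2 * I.b ^ 2) := by exact_mod_cast Nat.lt_size_self _

include hr hk4 hR6 hks in
/-- The period `Rint = r 2^(prec−k)` is positive and `2 Rint ≤ 2^prec (2 R + 2)`; `r > 0`.
[cite: BuchmannWilliams1988, §3 (semantics of the class-group table; supporting lemma)] -/
theorem walk_Rint : 0 < I.r ∧ 0 < I.Rint ∧ 2 * (I.Rint : ℝ) ≤ 2 ^ I.prec * (2 * Units.regulator K + 2) := by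
  have hl2 := Real.log_two_gt_d9
  have h2k : (16 : ℝ) ≤ 2 ^ I.k := by
    calc (16 : ℝ) = 2 ^ 4 := by norm_num
      _ ≤ 2 ^ I.k := pow_le_pow_right₀ (by norm_num) hk4
  rw [abs_le] at hr
  have hRk : 16 * (Real.log 2 / 6) ≤ 2 ^ I.k * Units.regulator K :=
    mul_le_mul h2k hR6 (by positivity) (by positivity)
  have hrpos : (0 : ℝ) < I.r := by nlinarith
  have hr0 : 0 < I.r := by exact_mod_cast hrpos
  refine ⟨hr0, by unfold Inst.Rint; positivity, ?_⟩
  have e : (I.Rint : ℝ) = I.r * 2 ^ (I.prec - I.k) := by unfold Inst.Rint; push_cast; ring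
  have e2 : (2 : ℝ) ^ I.prec = 2 ^ (I.prec - I.k) * 2 ^ I.k := by rw [← pow_add]; congr 1; omega
  rw [e, e2]
  have h1 : (I.r : ℝ) ≤ 2 ^ I.k * Units.regulator K + 1 := by linarith
  have h3 : (0 : ℝ) ≤ 2 ^ (I.prec - I.k) := by positivity
  have hR0 : 0 ≤ Units.regulator K := le_trans (by positivity) hR6
  nlinarith [mul_le_mul_of_nonneg_left h1 h3,
    mul_le_mul_of_nonneg_left (show (1 : ℝ) ≤ 2 ^ I.k by linarith) (by positivity : (0 : ℝ) ≤ 2 ^ (I.prec - I.k))]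

include hdeg hσ₂ hε hab hab1 hθ hred hprod hcap hprec hord hordm h6 hR6 hs₀ hTdbl hBb hmargin hr hk4 hks in
/-- **The walk package of a table position.**
[cite: BuchmannWilliams1988, §3 (semantics of the class-group table; supporting lemma)] -/
theorem walk_package (v : ℕ) (𝔤 : ℕ → Ideal (𝓞 K)) (γ : ℕ → K)
    (hslot : ∀ t < I.T, 𝔤 t ≠ ⊥ ∧ Canon (F.gT I v t) ∧
      (∀ φ : K, Mem θ I.b (F.gT I v t) φ ↔ φ ∈ (𝔤 t : FractionalIdeal (𝓞 K)⁰ K)) ∧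
      γ t ∈ (𝔤 t : FractionalIdeal (𝓞 K)⁰ K) ∧ 0 < σ₁ (γ t) ∧ ‖σ₂ (γ t)‖ < 1 ∧
      (∀ φ : K, φ ∈ (𝔤 t : FractionalIdeal (𝓞 K)⁰ K) → 0 < σ₁ φ → ‖σ₂ φ‖ < 1 → σ₁ (γ t) ≤ σ₁ φ)) :
    ∃ (β : K) (N : ℤ) (n : ℕ),
      β ∈ posRelMinima σ₁ σ₂ (∏ t ∈ Finset.range I.T, (𝔤 t : FractionalIdeal (𝓞 K)⁰ K) ^ I.digit v t) ∧
      Canon (F.cfinq I cap v).1 ∧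
      (∀ φ : K, Mem θ I.b (F.cfinq I cap v).1 φ ↔ φ ∈ FractionalIdeal.spanSingleton (𝓞 K)⁰ β⁻¹ *
        ∏ t ∈ Finset.range I.T, (𝔤 t : FractionalIdeal (𝓞 K)⁰ K) ^ I.digit v t) ∧
      (n : ℝ) ≤ 20 * ((10 * Nat.size (I.a * I.b) + 48 : ℕ) : ℝ) ^ 2 ∧
      |((F.cfinq I cap v).2 : ℝ) - 2 ^ I.prec * Real.log (σ₁ β)| ≤
        3 * (∑ t ∈ Finset.range I.T, (I.digit v t : ℝ)) +
          3 * ((6 * Nat.size (27 * I.a ^ 2 * I.b ^ 2) + 9 : ℕ) + 1) *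
            (2 ^ (6 * Nat.size (27 * I.a ^ 2 * I.b ^ 2) + 9) * ((I.s₀ : ℝ) + 1)) + n ∧
      0 ≤ F.tstarc I cap v - (F.cfinq I cap v).2 ∧
      ((F.tstarc I cap v - (F.cfinq I cap v).2 : ℤ) : ℝ) < (F.redc I cap (F.cfinq I cap v).1).2 ∧
      |((F.redc I cap (F.cfinq I cap v).1).2 : ℝ) - 2 ^ I.prec *
        (Real.log (σ₁ (voronoiSucc σ₁ σ₂ (∏ t ∈ Finset.range I.T, (𝔤 t : FractionalIdeal (𝓞 K)⁰ K) ^ I.digit v t) β)) -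
          Real.log (σ₁ β))| ≤ 1 ∧
      F.tstarc I cap v = I.tgt v + N * I.Rint ∧
      |(N : ℝ) - 2 ^ I.prec * (∑ t ∈ Finset.range I.T, (I.digit v t : ℝ) * Real.log (σ₁ (γ t))) / I.Rint| ≤
        2 + (3 * (∑ t ∈ Finset.range I.T, (I.digit v t : ℝ)) +
          2 ^ I.prec * (2 * Real.log (3 * Real.sqrt |(discr K : ℝ)|)) * (∑ t ∈ Finset.range I.T, (I.digit v t : ℝ))) / I.Rint := by
  set A : FractionalIdeal (𝓞 K)⁰ K := ∏ t ∈ Finset.range I.T, (𝔤 t : FractionalIdeal (𝓞 K)⁰ K) ^ I.digit v t with hA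
  set S : ℝ := ∑ t ∈ Finset.range I.T, (I.digit v t : ℝ) with hS
  set KN : ℕ := 10 * Nat.size (I.a * I.b) + 48 with hKN
  set LD : ℕ := Nat.size (27 * I.a ^ 2 * I.b ^ 2) with hLD
  set LB : ℝ := Real.log (3 * Real.sqrt |(discr K : ℝ)|) with hLB
  set L : ℕ := 6 * LD + 9 with hL
  obtain ⟨hLBKN, h9, hdLD, hd0⟩ := walk_consts hdeg hab hab1 hθ hprec
  obtain ⟨hL0, -⟩ := logB_bounds (K := K)
  obtain ⟨hK1, hK2, hdprec⟩ := Inst.KInt_ge (I := I) hdeg hab hab1 hθ hprec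
  obtain ⟨hr0, hRint0, h2Rint⟩ := walk_Rint (I := I) hR6 hr hk4 hks
  have hKIe : (I.KInt : ℝ) = 2 ^ I.prec * KN := by rw [hKN]; unfold Inst.KInt; push_cast; ring
  have hKN48 : 48 ≤ KN := by omega
  have hKN1 : (1 : ℝ) ≤ KN := by exact_mod_cast (show 1 ≤ KN by omega)
  -- (1) `b_E`
  obtain ⟨αE, hαE, hcE, hmE, honeE, herrE, hdrE⟩ := bEc_sem hdeg hσ₂ hab hab1 hθ hred hprod hcap hprec hord hordm v 𝔤 γ hslot
  rw [← hA] at hmE honeE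
  have hA0 : A ≠ 0 := by
    intro h; rw [h, mul_zero] at honeE
    exact one_ne_zero ((FractionalIdeal.mem_zero_iff (𝓞 K)⁰).mp honeE.1.1)
  -- (2) the target
  obtain ⟨N, hN, hlo, hhi⟩ := tstarc_decomp F I cap v hRint0
  have htgt := tgt_lt_Rint I v hr0 hks
  -- (3) the ladder
  have hp0 : 2 * (I.KInt : ℝ) ≤ (F.ladder I cap 0).2 := by
    obtain ⟨-, -, -, -, herr0⟩ := hbase_sem hdeg hσ₂ ε hε hab hab1 hθ hred hcap hord hordm (F := F) (I := I)
    have h1pos := one_mem_posRelMinima_one (σ₁ := σ₁) (σ₂ := σ₂) hdeg hσ₂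
    have hG := log_chain_six_gap (a := fun i => σ₁ (voronoiChain σ₁ σ₂ (1 : FractionalIdeal (𝓞 K)⁰ K) 1 i))
      (fun i => (voronoiChain_mem hdeg hσ₂ ε hε h1pos i).2) (voronoiChain_strictMono hdeg hσ₂ ε hε h1pos).monotone
      (h6 1 one_ne_zero 1 h1pos) I.s₀
    simp only [voronoiChain_zero, map_one, Real.log_one, sub_zero] at hG
    rw [hs₀] at herr0 hG
    rw [hKIe]
    have := num_hbase_lower (p₀ := ((F.hbase I cap).2 : ℝ)) h9 (by omega : 1 ≤ KN) (by exact_mod_cast herr0) hG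
    push_cast at this
    exact this
  have hC : ((F.ladder I cap 0).2 : ℝ) + I.KInt ≤ 2 ^ I.prec * (18 * KN * LB + KN) + 18 * KN := by
    obtain ⟨-, -, -, -, herr0⟩ := hbase_sem hdeg hσ₂ ε hε hab hab1 hθ hred hcap hord hordm (F := F) (I := I)
    have h1pos := one_mem_posRelMinima_one (σ₁ := σ₁) (σ₂ := σ₂) hdeg hσ₂
    have hup := log_voronoiChain_add_natCast_le hdeg hσ₂ ε hε h1pos 0 I.s₀
    simp only [voronoiChain_zero, map_one, Real.log_one, zero_add] at hup
    rw [abs_le] at herr0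
    change ((F.hbase I cap).2 : ℝ) + I.KInt ≤ _
    rw [hKIe]
    have hs0' : (I.s₀ : ℝ) = 18 * KN := by rw [hs₀]; push_cast; ring
    rw [hs0'] at herr0 hup
    have h2p : (0 : ℝ) ≤ 2 ^ I.prec := by positivity
    nlinarith [mul_le_mul_of_nonneg_left hup h2p]
  -- (4) the descent
  have hLT : L < I.Tdbl := by omega
  have hReg := regulator_le_abs_discr_pow_six K hdeg σ₁ σ₂ hσ₂
  have hlev : ∀ i, L < i → 2 * (I.Rint : ℝ) < (F.ladder I cap i).2 + I.KInt := by
    intro i hi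
    obtain ⟨hpi, -⟩ := ladder_growth hdeg hσ₂ ε hε hab hab1 hθ hred hprod hcap hprec hord hordm hp0 i
    refine num_levels hpi hK2 hi (h2Rint.trans ?_) hd0.le hdLD
    apply mul_le_mul_of_nonneg_left _ (by positivity); linarith
  have hX : F.tstarc I cap v - (I.margin : ℤ) = F.tstarc I cap v := by rw [hmargin]; simp
  obtain ⟨αd, hαd, hcd, hmd, honed, hρd, hltd, herrd⟩ :=
    descend_sem hdeg hσ₂ ε hε hab hab1 hθ hred hprod hcap hprec hord hordm hp0 hLT hlev (F.tstarc I cap v)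
      hαE hcE hmE honeE herrE (by linarith) (by exact_mod_cast hhi.le)
  have hc0q : F.c0q I cap v = F.descend I cap (F.tstarc I cap v) (F.bEc I cap v) := by unfold WalkFns.c0q; rw [hX]
  -- (5) the baby steps
  have hαdA : αd ∈ posRelMinima σ₁ σ₂ A := by
    have h := mul_mem_posRelMinima hαd honed
    rwa [mul_one, spanSingleton_mul_spanSingleton_inv_mul ((map_ne_zero σ₁).mp hαd.ne')] at h
  have hbudget := num_baby_budget (Bb := I.Bb) h9 hKN48 hLBKN hL0 hBb hC
  obtain ⟨n, hcn, hmn, hadv, hnC, hρn, hltn, hln⟩ :=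
    babySteps_sem hdeg hσ₂ ε hε hab hab1 hθ hred hcap v hαdA (h6 A hA0 αd hαdA) (st := F.c0q I cap v)
      (by rw [hc0q]; exact hcd) (fun φ => by rw [hc0q, voronoiChain_zero]; exact hmd φ) (by rw [hc0q]; exact hρd)
      (C := ((F.ladder I cap 0).2 : ℝ) + I.KInt) (by rw [hc0q]; exact hltd.le) hbudget
  have hnmax := num_nmax h9 hKN48 hLBKN hL0 hC hnC
  set β : K := voronoiChain σ₁ σ₂ A αd n with hβ
  have hβmem : β ∈ posRelMinima σ₁ σ₂ A := voronoiChain_mem hdeg hσ₂ ε hε hαdA n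
  have hsucc : voronoiSucc σ₁ σ₂ A β = voronoiChain σ₁ σ₂ A αd (n + 1) := by
    rw [hβ, ← voronoiChain_succ hdeg hσ₂ ε hε hαdA]
  -- read the conclusions on `cfinq = babyStepc^[Bb] c0q` (definitional)
  have hcn' : Canon (F.cfinq I cap v).1 := hcn
  have hmn' : ∀ φ : K, Mem θ I.b (F.cfinq I cap v).1 φ ↔ φ ∈ FractionalIdeal.spanSingleton (𝓞 K)⁰ β⁻¹ * A := hmn
  have hρn' : 0 ≤ F.tstarc I cap v - (F.cfinq I cap v).2 := hρn
  have hltn' : F.tstarc I cap v - (F.cfinq I cap v).2 < (F.redc I cap (F.cfinq I cap v).1).2 := hltn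
  have hln' : |((F.redc I cap (F.cfinq I cap v).1).2 : ℝ) - 2 ^ I.prec *
      (Real.log (σ₁ (voronoiChain σ₁ σ₂ A αd (n + 1))) - Real.log (σ₁ β))| ≤ 1 := hln
  have hadv' : |(((F.cfinq I cap v).2 - (F.c0q I cap v).2 : ℤ) : ℝ) - 2 ^ I.prec *
      (Real.log (σ₁ β) - Real.log (σ₁ αd))| ≤ n := by
    rw [voronoiChain_zero] at hadv; exact hadv
  rw [← hc0q] at herrd
  refine ⟨β, N, n, hβmem, hcn', hmn', hnmax, ?_, hρn', Int.cast_lt.mpr hltn', hsucc ▸ hln', hN, ?_⟩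
  · -- the position budget
    have e : ((F.cfinq I cap v).2 : ℝ) = (((F.cfinq I cap v).2 - (F.c0q I cap v).2 : ℤ) : ℝ) + (F.c0q I cap v).2 := by
      push_cast; ring
    rw [e, abs_le]
    rw [abs_le] at hadv' herrd
    constructor <;> linarith [hadv'.1, hadv'.2, herrd.1, herrd.2]
  · -- the drift of the wrap count
    have hRpos : (0 : ℝ) < I.Rint := by exact_mod_cast hRint0
    have h1 : |(N : ℝ) * I.Rint - (F.bEc I cap v).2| ≤ 2 * I.Rint := by
      have eN : (N : ℝ) * I.Rint = (F.tstarc I cap v : ℝ) - I.tgt v := by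
        have := congrArg (fun z : ℤ => (z : ℝ)) hN; push_cast at this; linarith
      rw [eN, abs_le]
      have hlo' : (I.Rint : ℝ) ≤ (F.tstarc I cap v : ℝ) - (F.bEc I cap v).2 := by exact_mod_cast hlo
      have hhi' : (F.tstarc I cap v : ℝ) - (F.bEc I cap v).2 < 2 * I.Rint := by exact_mod_cast hhi
      have htgt0 : (0 : ℝ) ≤ I.tgt v := by positivity
      have htgt' : (I.tgt v : ℝ) < I.Rint := by exact_mod_cast htgt
      constructor <;> linarith
    have h2 : |((F.bEc I cap v).2 : ℝ) - 2 ^ I.prec * ∑ t ∈ Finset.range I.T, (I.digit v t : ℝ) * Real.log (σ₁ (γ t))| ≤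
        3 * S + 2 ^ I.prec * (2 * LB) * S := by
      have e : ((F.bEc I cap v).2 : ℝ) - 2 ^ I.prec * ∑ t ∈ Finset.range I.T, (I.digit v t : ℝ) * Real.log (σ₁ (γ t)) =
          (((F.bEc I cap v).2 : ℝ) - 2 ^ I.prec * Real.log (σ₁ αE)) +
            2 ^ I.prec * (Real.log (σ₁ αE) - ∑ t ∈ Finset.range I.T, (I.digit v t : ℝ) * Real.log (σ₁ (γ t))) := by ring
      rw [e]
      refine (abs_add_le _ _).trans ?_
      rw [abs_mul, abs_of_pos (by positivity : (0 : ℝ) < 2 ^ I.prec)]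
      have h3 := mul_le_mul_of_nonneg_left hdrE (by positivity : (0 : ℝ) ≤ 2 ^ I.prec)
      have h4 : (2 : ℝ) ^ I.prec * (2 * Real.log (3 * Real.sqrt |(discr K : ℝ)|) * S) = 2 ^ I.prec * (2 * LB) * S := by
        rw [hLB]; ring
      linarith [herrE, h3, h4]
    -- divide by `Rint`
    have key : |(N : ℝ) - 2 ^ I.prec * (∑ t ∈ Finset.range I.T, (I.digit v t : ℝ) * Real.log (σ₁ (γ t))) / I.Rint| *
        I.Rint ≤ 2 * I.Rint + (3 * S + 2 ^ I.prec * (2 * LB) * S) := by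
      rw [← abs_of_pos hRpos, ← abs_mul, abs_of_pos hRpos, sub_mul, div_mul_cancel₀ _ hRpos.ne']
      rw [show (N : ℝ) * I.Rint - 2 ^ I.prec * ∑ t ∈ Finset.range I.T, (I.digit v t : ℝ) * Real.log (σ₁ (γ t)) =
          ((N : ℝ) * I.Rint - (F.bEc I cap v).2) +
            (((F.bEc I cap v).2 : ℝ) - 2 ^ I.prec * ∑ t ∈ Finset.range I.T, (I.digit v t : ℝ) * Real.log (σ₁ (γ t))) by ring]
      exact (abs_add_le _ _).trans (add_le_add h1 h2)
    rw [← le_div_iff₀ hRpos, add_div] at key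
    have e2 : 2 * (I.Rint : ℝ) / I.Rint = 2 := by field_simp
    rw [e2] at key
    exact key

end Walk

end Literature.Computability.Cryptography.CubicClassSampling.LinnikStubs

end Part5

/-!
## Part 6 — port of `Summits/QuantumAdvantage/QuantumAdvantage/Theorems/LinnikCubicClassGroupsPureCubicClassGroupFBQPStubSemCellB.lean` (3 declarations kept)

# `LinnikCubicClassGroups.PureCubicClassGroupFBQP` () — stub `stub_semMain`, part CELL (variant B)

Declarations of this Part (verbatim port; each keeps its own docstring and citation): `num_etaerr_halved`, `semMatch_cellB`, `semTable_value_eq_cellB`.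
-/

section Part6

namespace Literature.Computability.Cryptography.CubicClassSampling.LinnikStubs

open scoped _root_.NumberField nonZeroDivisors
open _root_.NumberField
open Literature.NumberTheory.CubicFields
open Literature.NumberTheory.CubicFields.PureCubicCodes (Canon Mem)

/-- **The drift budget with a factor two to spare**: `2^-k (1 + (2 + 48 T 2^ℓe LB)) ≤ R/2^(s+4)` (`LB ≤ 2^(LD+6)`, `T = 3|ps|`).
[cite: BuchmannWilliams1988, §3 (semantics of the class-group table; supporting lemma)] -/
theorem num_etaerr_halved {ℓe s npp LD e sz k np : ℕ} {R LB : ℝ} (hR : (1 : ℝ) / 16 ≤ R) (hsz : np < 2 ^ sz)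
    (hLB0 : 0 ≤ LB) (hLB : LB ≤ 2 ^ (LD + 6)) (hk : ℓe + s + npp + 60 + 6 * LD + e + 2 * sz ≤ k) :
    1 / 2 ^ k * (1 + (2 + 48 * (((3 * np : ℕ) : ℝ) * 2 ^ ℓe) * LB)) ≤ R / 2 ^ (s + 4) := by
  have hnp : (np : ℝ) ≤ 2 ^ sz := by exact_mod_cast hsz.le
  set M : ℕ := sz + ℓe + LD + 16 with hM
  have hsum : 1 + (2 + 48 * (((3 * np : ℕ) : ℝ) * 2 ^ ℓe) * LB) ≤ 2 ^ M := by
    have e1 : (2 : ℝ) ^ M = 2 ^ sz * 2 ^ ℓe * 2 ^ (LD + 6) * 1024 := by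
      rw [hM, show sz + ℓe + LD + 16 = sz + ℓe + (LD + 6) + 10 by omega, pow_add, pow_add, pow_add]; norm_num
    rw [e1]; push_cast
    have h1 : (1 : ℝ) ≤ 2 ^ sz * 2 ^ ℓe * 2 ^ (LD + 6) := by
      have a1 : (1:ℝ) ≤ 2 ^ sz := one_le_pow₀ (by norm_num)
      have a2 : (1:ℝ) ≤ 2 ^ ℓe := one_le_pow₀ (by norm_num)
      have a3 : (1:ℝ) ≤ 2 ^ (LD + 6) := one_le_pow₀ (by norm_num)
      calc (1:ℝ) = 1 * 1 * 1 := by ring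
        _ ≤ 2 ^ sz * 2 ^ ℓe * 2 ^ (LD + 6) := by gcongr
    have h2 : (np : ℝ) * 2 ^ ℓe * LB ≤ 2 ^ sz * 2 ^ ℓe * 2 ^ (LD + 6) := by gcongr
    nlinarith [mul_nonneg (mul_nonneg (by positivity : (0:ℝ) ≤ np) (by positivity : (0:ℝ) ≤ 2 ^ ℓe)) hLB0]
  have hexp : M + (s + 4) + 4 ≤ k := by omega
  have hpw : (2 : ℝ) ^ M * 2 ^ (s + 4) * 16 ≤ 2 ^ k := by
    rw [show (16 : ℝ) = 2 ^ 4 by norm_num, ← pow_add, ← pow_add]; exact pow_le_pow_right₀ (by norm_num) hexp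
  rw [one_div, inv_mul_eq_div, div_le_div_iff₀ (by positivity) (by positivity)]
  calc (1 + (2 + 48 * (((3 * np : ℕ) : ℝ) * 2 ^ ℓe) * LB)) * 2 ^ (s + 4) ≤ 2 ^ M * 2 ^ (s + 4) :=
        mul_le_mul_of_nonneg_right hsum (by positivity)
    _ ≤ 2 ^ k * (1 / 16) := by rw [mul_one_div, le_div_iff₀ (by norm_num)]; exact hpw
    _ ≤ 2 ^ k * R := mul_le_mul_of_nonneg_left hR (by positivity)
    _ = R * 2 ^ k := mul_comm _ _

/-- **Matching the stopping cell, real-variable form** (`match_cell` with an elementary proof; conclusions: the window of the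
target coordinate `u`, its index, and the integer cell offset).
[cite: BuchmannWilliams1988, §3 (semantics of the class-group table; supporting lemma)] -/
theorem semMatch_cellB {G : ℤ → ℝ} (hG : StrictMono G) {idx : ℝ → ℤ} (hidx : ∀ x, G (idx x) ≤ x ∧ x < G (idx x + 1))
    {prec npp : ℕ} (hnpp : npp ≤ prec) {tstarc pos l : ℤ} {logα εpos η : ℝ} (hε0 : 0 ≤ εpos) (k₀ : ℤ)
    (hpos : |(pos : ℝ) - 2 ^ prec * (logα + G k₀)| ≤ εpos) (hρ : 0 ≤ tstarc - pos)
    (hlt : ((tstarc - pos : ℤ) : ℝ) < l) (hl : |(l : ℝ) - 2 ^ prec * (G (k₀ + 1) - G k₀)| ≤ 1)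
    (hη : (εpos + 2) / 2 ^ prec ≤ η)
    (hfar : ∀ (k : ℤ) (m : ℕ), (m : ℝ) / 2 ^ npp < G (k + 1) - G k →
      η < |((tstarc : ℝ) / 2 ^ prec - logα) - (G k + m / 2 ^ npp)|) :
    (G k₀ < (tstarc : ℝ) / 2 ^ prec - logα ∧ (tstarc : ℝ) / 2 ^ prec - logα < G (k₀ + 1)) ∧
      idx ((tstarc : ℝ) / 2 ^ prec - logα) = k₀ ∧
      ((tstarc - pos).toNat / 2 ^ (prec - npp) : ℕ) =
        ⌊(((tstarc : ℝ) / 2 ^ prec - logα) - G (idx ((tstarc : ℝ) / 2 ^ prec - logα))) * 2 ^ npp⌋₊ := by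
  -- abbreviations
  have hP : (0 : ℝ) < 2 ^ prec := by positivity
  have hN : (0 : ℝ) < 2 ^ npp := by positivity
  set u : ℝ := (tstarc : ℝ) / 2 ^ prec - logα with hu
  have hgap : 0 < G (k₀ + 1) - G k₀ := sub_pos.mpr (hG (lt_add_one k₀))
  have hη0 : 0 < η := lt_of_lt_of_le (div_pos (by linarith) hP) hη
  obtain ⟨hpos1, hpos2⟩ := abs_le.mp hpos
  obtain ⟨hl1, hl2⟩ := abs_le.mp hl
  have hρ' : (pos : ℝ) ≤ tstarc := by exact_mod_cast (sub_nonneg.mp hρ)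
  have hlt' : (tstarc : ℝ) - pos < l := by push_cast at hlt; exact hlt
  -- `u · 2^prec = tstarc − 2^prec logα`
  have huP : u * 2 ^ prec = tstarc - 2 ^ prec * logα := by
    rw [hu, sub_mul, div_mul_cancel₀ _ hP.ne']; ring
  -- (1) the window of `u` from the position data: `G k₀ − εpos/P ≤ u < G (k₀+1) + (εpos+1)/P`
  have hlow : (G k₀ - u) * 2 ^ prec ≤ εpos := by
    have e : (G k₀ - u) * 2 ^ prec = 2 ^ prec * (logα + G k₀) - tstarc := by rw [sub_mul, huP]; ring
    rw [e]; linarith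
  have hupp : (u - G (k₀ + 1)) * 2 ^ prec < εpos + 1 := by
    have e : (u - G (k₀ + 1)) * 2 ^ prec = tstarc - 2 ^ prec * (logα + G k₀) - 2 ^ prec * (G (k₀ + 1) - G k₀) := by
      rw [sub_mul, huP]; ring
    rw [e]; linarith
  -- (2) sharpen with `hfar` at the two chain points
  have hηP : εpos + 1 < η * 2 ^ prec := by
    have h := (div_le_iff₀ hP).mp hη
    linarith
  have hfar0 := hfar k₀ 0 (by rw [Nat.cast_zero, zero_div]; exact hgap)
  have hfar1 := hfar (k₀ + 1) 0 (by rw [Nat.cast_zero, zero_div]; exact sub_pos.mpr (hG (lt_add_one _)))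
  rw [Nat.cast_zero, zero_div, add_zero] at hfar0 hfar1
  have hk1 : G k₀ < u := by
    rcases lt_abs.mp hfar0 with h | h
    · linarith
    · -- `u ≤ G k₀ − η` contradicts `G k₀ − u ≤ εpos/P < η`
      exfalso
      have h2 : η * 2 ^ prec < (G k₀ - u) * 2 ^ prec := mul_lt_mul_of_pos_right (by linarith) hP
      linarith
  have hk2η : u < G (k₀ + 1) - η := by
    rcases lt_abs.mp hfar1 with h | h
    · exfalso
      have h2 : η * 2 ^ prec < (u - G (k₀ + 1)) * 2 ^ prec := mul_lt_mul_of_pos_right (by linarith) hP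
      linarith
    · linarith
  have hk2 : u < G (k₀ + 1) := by linarith
  have hidxu : idx u = k₀ := chain_index_eq hG hidx hk1.le hk2
  refine ⟨⟨hk1, hk2⟩, hidxu, ?_⟩
  rw [hidxu]
  -- (3) the offset
  have htn : (((tstarc - pos).toNat : ℕ) : ℝ) = (tstarc : ℝ) - pos := by
    have h : (((tstarc - pos).toNat : ℕ) : ℤ) = tstarc - pos := Int.toNat_of_nonneg hρ
    have h' := congrArg (fun z : ℤ => (z : ℝ)) h
    push_cast at h'
    exact h'
  rw [← Nat.floor_div_eq_div (K := ℝ), htn]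
  -- `(tstarc − pos)/2^(prec−npp) = x + δ`
  set x : ℝ := (u - G k₀) * 2 ^ npp with hx
  set δ : ℝ := (2 ^ prec * (logα + G k₀) - pos) * 2 ^ npp / 2 ^ prec with hδ
  have hpe : ((2 ^ (prec - npp) : ℕ) : ℝ) = 2 ^ prec / 2 ^ npp := by
    rw [eq_div_iff hN.ne']; push_cast; rw [← pow_add]; congr 1; omega
  have hxδ : ((tstarc : ℝ) - pos) / ((2 ^ (prec - npp) : ℕ) : ℝ) = x + δ := by
    rw [hpe, hx, hδ, hu]
    field_simp
    ring
  rw [hxδ]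
  have hx0 : 0 ≤ x := mul_nonneg (by linarith) hN.le
  have hδle : |δ| * 2 ^ prec ≤ εpos * 2 ^ npp := by
    rw [hδ, abs_div, abs_of_pos hP, div_mul_cancel₀ _ hP.ne', abs_mul, abs_of_pos hN]
    exact mul_le_mul_of_nonneg_right (abs_le.mpr ⟨by linarith, by linarith⟩) hN.le
  have hδη : |δ| < η * 2 ^ npp := by
    -- `|δ| ≤ εpos 2^npp / 2^prec < η 2^npp`
    have h1 : |δ| ≤ εpos * 2 ^ npp / 2 ^ prec := (le_div_iff₀ hP).mpr hδle
    have h2 : εpos * 2 ^ npp / 2 ^ prec < η * 2 ^ npp := by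
      rw [div_lt_iff₀ hP]
      have h3 : εpos < η * 2 ^ prec := by linarith
      calc εpos * 2 ^ npp < η * 2 ^ prec * 2 ^ npp := mul_lt_mul_of_pos_right h3 hN
        _ = η * 2 ^ npp * 2 ^ prec := by ring
    exact h1.trans_lt h2
  obtain ⟨hδ1, hδ2⟩ := abs_lt.mp hδη
  set m₀ : ℕ := ⌊x⌋₊ with hm₀
  have hm₀le : (m₀ : ℝ) ≤ x := Nat.floor_le hx0
  have hm₀lt : x < m₀ + 1 := Nat.lt_floor_add_one x
  have hxgap : x < (G (k₀ + 1) - G k₀ - η) * 2 ^ npp := by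
    rw [hx]; exact mul_lt_mul_of_pos_right (by linarith) hN
  -- `hfar` at `(k₀, m)` in grid units: `η 2^npp < |x − m|`
  have hfarx : ∀ m : ℕ, (m : ℝ) / 2 ^ npp < G (k₀ + 1) - G k₀ → η * 2 ^ npp < |x - m| := by
    intro m hm
    have h := hfar k₀ m hm
    have e : u - (G k₀ + m / 2 ^ npp) = (x - m) / 2 ^ npp := by
      rw [hx]; field_simp; ring
    rw [e, abs_div, abs_of_pos hN, lt_div_iff₀ hN] at h
    exact h
  -- lower bound `m₀ ≤ x + δ`
  have hlb : (m₀ : ℝ) ≤ x + δ := by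
    by_cases hm : (m₀ : ℝ) / 2 ^ npp < G (k₀ + 1) - G k₀
    · have h := hfarx m₀ hm
      rw [abs_of_nonneg (by linarith : 0 ≤ x - m₀)] at h
      linarith
    · exfalso
      have h' : G (k₀ + 1) - G k₀ ≤ (m₀ : ℝ) / 2 ^ npp := not_lt.mp hm
      rw [le_div_iff₀ hN] at h'
      have hηN : 0 < η * 2 ^ npp := mul_pos hη0 hN
      have e : (G (k₀ + 1) - G k₀ - η) * 2 ^ npp = (G (k₀ + 1) - G k₀) * 2 ^ npp - η * 2 ^ npp := by ring
      rw [e] at hxgap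
      linarith
  -- upper bound `x + δ < m₀ + 1`
  have hub : x + δ < m₀ + 1 := by
    by_cases hm : ((m₀ + 1 : ℕ) : ℝ) / 2 ^ npp < G (k₀ + 1) - G k₀
    · have h := hfarx (m₀ + 1) hm
      push_cast at h
      rw [abs_of_nonpos (by linarith : x - (m₀ + 1) ≤ 0)] at h
      linarith
    · have h' : G (k₀ + 1) - G k₀ ≤ ((m₀ + 1 : ℕ) : ℝ) / 2 ^ npp := not_lt.mp hm
      rw [le_div_iff₀ hN] at h'
      push_cast at h'
      have e : (G (k₀ + 1) - G k₀ - η) * 2 ^ npp = (G (k₀ + 1) - G k₀) * 2 ^ npp - η * 2 ^ npp := by ring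
      rw [e] at hxgap
      linarith
  rw [Nat.floor_eq_iff (le_trans (Nat.cast_nonneg _) hlb)]
  exact ⟨hlb, hub⟩

section Table

variable {K : Type} [Field K] [NumberField K] {a b : ℕ} {θ : K} {σ₁ : K →+* ℝ} {σ₂ : K →+* ℂ}
variable (hdeg : Module.finrank ℚ K = 3) (hσ₂ : ∃ z : K, starRingEnd ℂ (σ₂ z) ≠ σ₂ z)
  (ε : (𝓞 K)ˣ) (hε : 1 < σ₁ (algebraMap (𝓞 K) K ε))
  (hab : Squarefree (a * b)) (hab1 : a * b ≠ 1) (hθ : θ ^ 3 = ((a * b ^ 2 : ℕ) : K))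

include hdeg hσ₂ hε hab hab1 hθ in
/-- **The table value equals the ideal cell value** (`table_value_eq_cell`, component-wise, plus: the chain point of the cell lies strictly left of the target).
[cite: BuchmannWilliams1988, §3 (semantics of the class-group table; supporting lemma)] -/
theorem semTable_value_eq_cellB {Ag : FractionalIdeal (𝓞 K)⁰ K} {x₀ : K} (hx₀ : x₀ ∈ posRelMinima σ₁ σ₂ Ag)
    {Lab : ℤ → ℕ × List ℤ} (hLab : ∀ i, Canon (Lab i) ∧ ∀ φ : K, Mem θ b (Lab i) φ ↔
      φ ∈ FractionalIdeal.spanSingleton (𝓞 K)⁰ (voronoiChain σ₁ σ₂ Ag x₀ i)⁻¹ * Ag)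
    {idx : ℝ → ℤ} (hidx : ∀ x, Real.log (σ₁ (voronoiChain σ₁ σ₂ Ag x₀ (idx x))) ≤ x ∧
      x < Real.log (σ₁ (voronoiChain σ₁ σ₂ Ag x₀ (idx x + 1))))
    {α : K} (hα : 0 < σ₁ α) {β : K} (hβ : β ∈ posRelMinima σ₁ σ₂ (FractionalIdeal.spanSingleton (𝓞 K)⁰ α * Ag))
    {c₁ : ℕ × List ℤ} (hc₁ : Canon c₁)
    (hm₁ : ∀ φ : K, Mem θ b c₁ φ ↔ φ ∈ FractionalIdeal.spanSingleton (𝓞 K)⁰ β⁻¹ * (FractionalIdeal.spanSingleton (𝓞 K)⁰ α * Ag))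
    {prec npp : ℕ} (hnpp : npp ≤ prec) {tstarc pos l : ℤ} {εpos η : ℝ} (hε0 : 0 ≤ εpos)
    (hpos : |(pos : ℝ) - 2 ^ prec * Real.log (σ₁ β)| ≤ εpos) (hρ : 0 ≤ tstarc - pos)
    (hlt : ((tstarc - pos : ℤ) : ℝ) < l)
    (hl : |(l : ℝ) - 2 ^ prec * (Real.log (σ₁ (voronoiSucc σ₁ σ₂ (FractionalIdeal.spanSingleton (𝓞 K)⁰ α * Ag) β)) -
      Real.log (σ₁ β))| ≤ 1)
    (hη : (εpos + 2) / 2 ^ prec ≤ η)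
    (hfar : ∀ (k : ℤ) (m : ℕ), (m : ℝ) / 2 ^ npp < Real.log (σ₁ (voronoiChain σ₁ σ₂ Ag x₀ (k + 1))) -
        Real.log (σ₁ (voronoiChain σ₁ σ₂ Ag x₀ k)) →
      η < |((tstarc : ℝ) / 2 ^ prec - Real.log (σ₁ α)) -
        (Real.log (σ₁ (voronoiChain σ₁ σ₂ Ag x₀ k)) + m / 2 ^ npp)|) :
    c₁ = Lab (idx ((tstarc : ℝ) / 2 ^ prec - Real.log (σ₁ α))) ∧
      ((tstarc - pos).toNat / 2 ^ (prec - npp) : ℕ) =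
        ⌊(((tstarc : ℝ) / 2 ^ prec - Real.log (σ₁ α)) -
          Real.log (σ₁ (voronoiChain σ₁ σ₂ Ag x₀ (idx ((tstarc : ℝ) / 2 ^ prec - Real.log (σ₁ α)))))) * 2 ^ npp⌋₊ ∧
      Real.log (σ₁ (voronoiChain σ₁ σ₂ Ag x₀ (idx ((tstarc : ℝ) / 2 ^ prec - Real.log (σ₁ α))))) <
        (tstarc : ℝ) / 2 ^ prec - Real.log (σ₁ α) := by
  have hα0 : α ≠ 0 := (map_ne_zero σ₁).mp hα.ne'
  have hmem := fun i => voronoiChain_mem hdeg hσ₂ ε hε hx₀ i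
  have hpos' : ∀ i, 0 < σ₁ (voronoiChain σ₁ σ₂ Ag x₀ i) := fun i => (hmem i).2
  set G : ℤ → ℝ := fun i => Real.log (σ₁ (voronoiChain σ₁ σ₂ Ag x₀ i)) with hG
  have hGm : StrictMono G := fun i j hij => Real.log_lt_log (hpos' i) (voronoiChain_strictMono hdeg hσ₂ ε hε hx₀ hij)
  -- `β = α θ(k₀)`
  obtain ⟨k₀, hk₀⟩ := exists_voronoiChain_eq hdeg hσ₂ ε hε hx₀ (inv_mul_mem_posRelMinima hα hβ)
  have hβeq : β = α * voronoiChain σ₁ σ₂ Ag x₀ k₀ := by rw [hk₀, ← mul_assoc, mul_inv_cancel₀ hα0, one_mul]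
  have hlogβ : Real.log (σ₁ β) = Real.log (σ₁ α) + G k₀ := by
    rw [hβeq, map_mul, Real.log_mul hα.ne' (hpos' k₀).ne']
  have hsucc : voronoiSucc σ₁ σ₂ (FractionalIdeal.spanSingleton (𝓞 K)⁰ α * Ag) β = α * voronoiChain σ₁ σ₂ Ag x₀ (k₀ + 1) := by
    rw [hβeq, voronoiSucc_mul hdeg hσ₂ ε hε hα (hmem k₀), voronoiChain_succ hdeg hσ₂ ε hε hx₀]
  have hlogsucc : Real.log (σ₁ (voronoiSucc σ₁ σ₂ (FractionalIdeal.spanSingleton (𝓞 K)⁰ α * Ag) β)) - Real.log (σ₁ β) =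
      G (k₀ + 1) - G k₀ := by
    rw [hsucc, hlogβ, map_mul, Real.log_mul hα.ne' (hpos' _).ne']; ring
  rw [hlogβ] at hpos
  rw [hlogsucc] at hl
  obtain ⟨⟨hwlo, -⟩, hidxu, hoff⟩ := semMatch_cellB hGm hidx hnpp hε0 k₀ hpos hρ hlt hl hη hfar
  refine ⟨?_, hoff, by rw [hidxu]; exact hwlo⟩
  -- the two canonical codes of `θ(k₀)⁻¹ A_g`
  rw [hidxu]
  have hind := fun c₀ c₁ c₂ h => Literature.NumberTheory.NumberFields.PureCubic.coords_eq_zero (K := K) hdeg hab hab1 hθ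
    (c₀ := c₀) (c₁ := c₁) (c₂ := c₂) h
  apply PureCubicCodes.canon_unique θ b hind _ _ hc₁ (hLab k₀).1
  intro φ
  rw [hm₁ φ, (hLab k₀).2 φ, hβeq, mul_inv, ← FractionalIdeal.spanSingleton_mul_spanSingleton]
  have e : FractionalIdeal.spanSingleton (𝓞 K)⁰ α⁻¹ * FractionalIdeal.spanSingleton (𝓞 K)⁰ (voronoiChain σ₁ σ₂ Ag x₀ k₀)⁻¹ *
      (FractionalIdeal.spanSingleton (𝓞 K)⁰ α * Ag) =
      FractionalIdeal.spanSingleton (𝓞 K)⁰ (voronoiChain σ₁ σ₂ Ag x₀ k₀)⁻¹ * Ag := by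
    rw [mul_comm (FractionalIdeal.spanSingleton (𝓞 K)⁰ α⁻¹), mul_assoc, ← mul_assoc (FractionalIdeal.spanSingleton (𝓞 K)⁰ α⁻¹),
      FractionalIdeal.spanSingleton_mul_spanSingleton, inv_mul_cancel₀ hα0, FractionalIdeal.spanSingleton_one, one_mul]
  rw [e]

end Table

end Literature.Computability.Cryptography.CubicClassSampling.LinnikStubs

end Part6

/-!
## Part 7 — port of `Summits/QuantumAdvantage/QuantumAdvantage/Theorems/LinnikCubicClassGroupsPureCubicClassGroupFBQPStubClassTableSemNumerics2.lean` (4 declarations kept)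

# `LinnikCubicClassGroups.PureCubicClassGroupFBQP` () — stub `stub_classTableSem`, part NUMERICS II

Declarations of this Part (verbatim port; each keeps its own docstring and citation): `num_KN_le`, `num_eta`, `num_BN`, `num_defect_card`.
-/

section Part7

namespace Literature.Computability.Cryptography.CubicClassSampling.LinnikStubs

/-- `KN = 10 size(ab) + 48 ≤ 2^(LD + 6)` when `size(ab) ≤ LD`.
[cite: BuchmannWilliams1988, §3 (semantics of the class-group table; supporting lemma)] -/
theorem num_KN_le {sab LD : ℕ} (h : sab ≤ LD) : ((10 * sab + 48 : ℕ) : ℝ) ≤ 2 ^ (LD + 6) := by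
  have h1 : (LD : ℝ) ≤ 2 ^ LD := by exact_mod_cast (Nat.lt_two_pow_self).le
  have h2 : (1 : ℝ) ≤ 2 ^ LD := one_le_pow₀ (by norm_num)
  have h3 : (sab : ℝ) ≤ LD := by exact_mod_cast h
  rw [pow_add]; push_cast; nlinarith

/-- **The position-error budget fits**: `(3 T 2^ℓe + 3 (L+1) 2^L (s₀+1) + 20 KN² + 2)/2^prec ≤ R/2^(s+3)`
(`L = 6 LD + 9`, `s₀ = 18 KN`, `T = 3|ps|`).
[cite: BuchmannWilliams1988, §3 (semantics of the class-group table; supporting lemma)] -/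
theorem num_eta {ℓe s npp LD e sz k prec np sab : ℕ} {R : ℝ} (hR : (1 : ℝ) / 16 ≤ R) (hsz : np < 2 ^ sz) (hsab : sab ≤ LD)
    (hk : ℓe + s + npp + 60 + 6 * LD + e + 2 * sz ≤ k) (hprec : k + s + npp + 64 ≤ prec) (hs : npp + 6 * LD + 50 + e ≤ s) :
    (3 * ((3 * np : ℕ) : ℝ) * 2 ^ ℓe + 3 * (((6 * LD + 9 : ℕ) : ℝ) + 1) * (2 ^ (6 * LD + 9) * (((18 * (10 * sab + 48) : ℕ) : ℝ) + 1)) +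
        20 * ((10 * sab + 48 : ℕ) : ℝ) ^ 2 + 2) / 2 ^ prec ≤ R / 2 ^ (s + 3) := by
  have hKN := num_KN_le hsab
  have hnp : (np : ℝ) ≤ 2 ^ sz := by exact_mod_cast hsz.le
  have hLDp : (LD : ℝ) ≤ 2 ^ LD := by exact_mod_cast (Nat.lt_two_pow_self).le
  have h1LD : (1 : ℝ) ≤ 2 ^ LD := one_le_pow₀ (by norm_num)
  -- bound each term by a power of two with exponent `M = sz + ℓe + 8 LD + 26`
  set M : ℕ := sz + ℓe + 8 * LD + 26 with hM
  have hA : 3 * ((3 * np : ℕ) : ℝ) * 2 ^ ℓe ≤ 2 ^ M := by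
    have : (2 : ℝ) ^ (sz + ℓe + 4) ≤ 2 ^ M := pow_le_pow_right₀ (by norm_num) (by omega)
    have e1 : (2 : ℝ) ^ (sz + ℓe + 4) = 2 ^ sz * 2 ^ ℓe * 16 := by rw [pow_add, pow_add]; norm_num
    push_cast; nlinarith [show (0 : ℝ) ≤ 2 ^ ℓe by positivity, mul_le_mul_of_nonneg_right hnp (by positivity : (0 : ℝ) ≤ 2 ^ ℓe)]
  have hB : 3 * (((6 * LD + 9 : ℕ) : ℝ) + 1) * (2 ^ (6 * LD + 9) * (((18 * (10 * sab + 48) : ℕ) : ℝ) + 1)) ≤ 2 ^ M := by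
    have hL : ((6 * LD + 9 : ℕ) : ℝ) + 1 ≤ 16 * 2 ^ LD := by push_cast; nlinarith
    have hS : ((18 * (10 * sab + 48) : ℕ) : ℝ) + 1 ≤ 2 ^ (LD + 11) := by
      rw [pow_add]; push_cast; push_cast at hKN; rw [pow_add] at hKN; nlinarith
    have : (2 : ℝ) ^ (8 * LD + 26) ≤ 2 ^ M := pow_le_pow_right₀ (by norm_num) (by omega)
    have e1 : (2 : ℝ) ^ (8 * LD + 26) = 64 * (2 ^ LD * (2 ^ (6 * LD + 9) * 2 ^ (LD + 11))) := by
      rw [show 8 * LD + 26 = 6 + (LD + ((6 * LD + 9) + (LD + 11))) by omega, pow_add, pow_add, pow_add]; norm_num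
    calc 3 * (((6 * LD + 9 : ℕ) : ℝ) + 1) * (2 ^ (6 * LD + 9) * (((18 * (10 * sab + 48) : ℕ) : ℝ) + 1))
        ≤ 3 * (16 * 2 ^ LD) * (2 ^ (6 * LD + 9) * 2 ^ (LD + 11)) := by gcongr
      _ ≤ 2 ^ (8 * LD + 26) := by rw [e1]; nlinarith [show (0:ℝ) ≤ 2 ^ LD * (2 ^ (6 * LD + 9) * 2 ^ (LD + 11)) by positivity]
      _ ≤ 2 ^ M := this
  have hC : 20 * ((10 * sab + 48 : ℕ) : ℝ) ^ 2 + 2 ≤ 2 ^ M := by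
    have : (2 : ℝ) ^ (2 * LD + 17) ≤ 2 ^ M := pow_le_pow_right₀ (by norm_num) (by omega)
    have e1 : (2 : ℝ) ^ (2 * LD + 17) = (2 ^ (LD + 6)) ^ 2 * 32 := by
      rw [← pow_mul, show (32 : ℝ) = 2 ^ 5 by norm_num, ← pow_add]; congr 1; omega
    have h0 : (0 : ℝ) ≤ ((10 * sab + 48 : ℕ) : ℝ) := by positivity
    have hsq : ((10 * sab + 48 : ℕ) : ℝ) ^ 2 ≤ (2 ^ (LD + 6)) ^ 2 := pow_le_pow_left₀ h0 hKN 2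
    have h64 : (64 : ℝ) ^ 2 ≤ (2 ^ (LD + 6)) ^ 2 := by
      apply pow_le_pow_left₀ (by norm_num); rw [pow_add]; nlinarith
    nlinarith
  have hsum : 3 * ((3 * np : ℕ) : ℝ) * 2 ^ ℓe + 3 * (((6 * LD + 9 : ℕ) : ℝ) + 1) * (2 ^ (6 * LD + 9) * (((18 * (10 * sab + 48) : ℕ) : ℝ) + 1)) +
      20 * ((10 * sab + 48 : ℕ) : ℝ) ^ 2 + 2 ≤ 2 ^ (M + 2) := by
    have : (2 : ℝ) ^ (M + 2) = 2 ^ M * 4 := by rw [pow_add]; norm_num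
    have hM0 : (0 : ℝ) ≤ 2 ^ M := by positivity
    linarith
  -- compare exponents
  have hexp : M + 2 + (s + 3) + 4 ≤ prec := by omega
  have hpw : (2 : ℝ) ^ (M + 2) * 2 ^ (s + 3) * 16 ≤ 2 ^ prec := by
    rw [show (16 : ℝ) = 2 ^ 4 by norm_num, ← pow_add, ← pow_add]; exact pow_le_pow_right₀ (by norm_num) hexp
  rw [div_le_div_iff₀ (by positivity) (by positivity)]
  calc (3 * ((3 * np : ℕ) : ℝ) * 2 ^ ℓe + 3 * (((6 * LD + 9 : ℕ) : ℝ) + 1) * (2 ^ (6 * LD + 9) * (((18 * (10 * sab + 48) : ℕ) : ℝ) + 1)) +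
        20 * ((10 * sab + 48 : ℕ) : ℝ) ^ 2 + 2) * 2 ^ (s + 3)
      ≤ 2 ^ (M + 2) * 2 ^ (s + 3) := mul_le_mul_of_nonneg_right hsum (by positivity)
    _ ≤ 2 ^ prec * (1 / 16) := by rw [mul_one_div, le_div_iff₀ (by norm_num)]; exact hpw
    _ ≤ 2 ^ prec * R := mul_le_mul_of_nonneg_left hR (by positivity)
    _ = R * 2 ^ prec := mul_comm _ _

/-- **The wrap-count budget**: `BN = 2 + (3S + 2^prec 2 LB S)/Rint ≤ 2 + 48 T 2^ℓe LB`.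
[cite: BuchmannWilliams1988, §3 (semantics of the class-group table; supporting lemma)] -/
theorem num_BN {prec : ℕ} {S Tm LB Rint : ℝ} (hS0 : 0 ≤ S) (hS : S ≤ Tm) (hLB : 3 / 2 ^ prec ≤ LB)
    (hRint : 2 ^ prec / 16 ≤ Rint) :
    2 + (3 * S + 2 ^ prec * (2 * LB) * S) / Rint ≤ 2 + 48 * Tm * LB := by
  have h2p : (0 : ℝ) < 2 ^ prec := by positivity
  have hR0 : 0 < Rint := lt_of_lt_of_le (by positivity) hRint
  have hLB0 : 0 ≤ LB := le_trans (by positivity) hLB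
  have h3 : 3 * S ≤ 2 ^ prec * LB * S := by
    have := mul_le_mul_of_nonneg_right hLB hS0
    rw [div_mul_eq_mul_div, div_le_iff₀ h2p] at this
    nlinarith
  have hnum : 3 * S + 2 ^ prec * (2 * LB) * S ≤ 2 ^ prec * (3 * LB * Tm) := by nlinarith [mul_le_mul_of_nonneg_left hS hLB0]
  have : (3 * S + 2 ^ prec * (2 * LB) * S) / Rint ≤ 48 * Tm * LB := by
    rw [div_le_iff₀ hR0]
    calc 3 * S + 2 ^ prec * (2 * LB) * S ≤ 2 ^ prec * (3 * LB * Tm) := hnum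
      _ = (48 * Tm * LB) * (2 ^ prec / 16) := by ring
      _ ≤ (48 * Tm * LB) * Rint := mul_le_mul_of_nonneg_left hRint (mul_nonneg (mul_nonneg (by norm_num) (hS0.trans hS)) hLB0)
  linarith

/-- **The defect count per exponent block**: `2 (2^npp (q R + LB) + q n₀ + 1) ≤ 2^-(30+e) 2^ℓy` for `q = 2^(ℓy−s) + 1`,
`R, LB ≤ d⁶`, `n₀ ≤ 9 d⁶`, `d < 2^LD`, `s ≥ npp + 6 LD + 36 + e`, `s ≤ ℓy`.
[cite: BuchmannWilliams1988, §3 (semantics of the class-group table; supporting lemma)] -/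
theorem num_defect_card {npp s ℓy LD e n₀ : ℕ} {R LB d : ℝ} (hR0 : 0 ≤ R) (hRd : R ≤ d ^ 6) (hLB : LB ≤ d ^ 6)
    (hn₀ : (n₀ : ℝ) ≤ 9 * d ^ 6) (hd1 : 1 ≤ d) (hd : d < 2 ^ LD) (hs : npp + 6 * LD + 36 + e ≤ s) (hsy : s ≤ ℓy) :
    2 * (2 ^ npp * (((2 ^ (ℓy - s) + 1 : ℕ) : ℝ) * R + LB) + ((2 ^ (ℓy - s) + 1 : ℕ) : ℝ) * n₀ + 1) ≤
      (1 / 2) ^ (30 + e) * 2 ^ ℓy := by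
  have hd6 : d ^ 6 < (2 : ℝ) ^ (6 * LD) := by
    calc d ^ 6 < ((2 : ℝ) ^ LD) ^ 6 := pow_lt_pow_left₀ hd (by linarith) (by norm_num)
      _ = 2 ^ (6 * LD) := by rw [← pow_mul, mul_comm]
  have hd61 : (1 : ℝ) ≤ d ^ 6 := one_le_pow₀ hd1
  have hq : ((2 ^ (ℓy - s) + 1 : ℕ) : ℝ) ≤ 2 ^ (ℓy - s + 1) := by
    have h : 2 ^ (ℓy - s) + 1 ≤ 2 ^ (ℓy - s + 1) := by
      rw [pow_succ]; have := Nat.one_le_two_pow (n := ℓy - s); omega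
    exact_mod_cast h
  have hq0 : (0 : ℝ) ≤ ((2 ^ (ℓy - s) + 1 : ℕ) : ℝ) := by positivity
  -- `LHS ≤ 2^(ℓy - s + 1) d⁶ 2^(npp + 5)`
  have h1 : 2 * (2 ^ npp * (((2 ^ (ℓy - s) + 1 : ℕ) : ℝ) * R + LB) + ((2 ^ (ℓy - s) + 1 : ℕ) : ℝ) * n₀ + 1) ≤
      2 ^ (ℓy - s + 1) * d ^ 6 * 2 ^ (npp + 5) := by
    set q : ℝ := ((2 ^ (ℓy - s) + 1 : ℕ) : ℝ) with hqdef
    have hq1 : 1 ≤ q := by rw [hqdef]; exact_mod_cast Nat.le_add_left 1 (2 ^ (ℓy - s))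
    have h2n : (1 : ℝ) ≤ 2 ^ npp := one_le_pow₀ (by norm_num)
    have e5 : (2 : ℝ) ^ (npp + 5) = 2 ^ npp * 32 := by rw [pow_add]; norm_num
    rw [e5]
    have a1 : q * R + LB ≤ 2 * q * d ^ 6 := by nlinarith
    have a2 : q * (n₀ : ℝ) ≤ 9 * q * d ^ 6 := by nlinarith
    have a3 : (1 : ℝ) ≤ q * d ^ 6 := by nlinarith
    calc 2 * (2 ^ npp * (q * R + LB) + q * n₀ + 1) ≤ 2 * (2 ^ npp * (2 * q * d ^ 6) + 9 * q * d ^ 6 + q * d ^ 6) := by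
          gcongr
      _ = q * d ^ 6 * (4 * 2 ^ npp + 20) := by ring
      _ ≤ q * d ^ 6 * (2 ^ npp * 32) := by
          apply mul_le_mul_of_nonneg_left _ (by positivity); nlinarith
      _ ≤ 2 ^ (ℓy - s + 1) * d ^ 6 * (2 ^ npp * 32) := by gcongr
  refine h1.trans ?_
  -- `2^(ℓy - s + 1) d⁶ 2^(npp+5) ≤ 2^(ℓy - s + 1 + 6 LD + npp + 5) ≤ 2^-(30+e) 2^ℓy`
  have h2 : (2 : ℝ) ^ (ℓy - s + 1) * d ^ 6 * 2 ^ (npp + 5) ≤ 2 ^ (ℓy - s + 1 + 6 * LD + (npp + 5)) := by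
    rw [pow_add _ (ℓy - s + 1 + 6 * LD), pow_add _ (ℓy - s + 1)]
    gcongr
  refine h2.trans ?_
  have hexp : ℓy - s + 1 + 6 * LD + (npp + 5) + (30 + e) ≤ ℓy := by omega
  have : (2 : ℝ) ^ (ℓy - s + 1 + 6 * LD + (npp + 5)) * 2 ^ (30 + e) ≤ 2 ^ ℓy := by
    rw [← pow_add]; exact pow_le_pow_right₀ (by norm_num) hexp
  rw [one_div, inv_pow, ← div_eq_inv_mul, le_div_iff₀ (by positivity)]
  exact this

end Literature.Computability.Cryptography.CubicClassSampling.LinnikStubs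

end Part7

/-!
## Part 8 — port of `Summits/QuantumAdvantage/QuantumAdvantage/Theorems/LinnikCubicClassGroupsPureCubicClassGroupFBQPStubSemSetup.lean` (10 declarations kept)

# `LinnikCubicClassGroups.PureCubicClassGroupFBQP` () — stub `stub_semMain`, part SETUP

Declarations of this Part (verbatim port; each keeps its own docstring and citation): `inst_pos_decomp`, `size_ab_le`, `inst_numerics`, `regulator_sixteenth_le`, `regulator_ge_of_period`, `period_le_nine_pow_six`, `logB_le_pow_six`, `three_div_le_logB`, `Rint_ge`, `prime_le_cap`.
-/

section Part8

namespace Literature.Computability.Cryptography.CubicClassSampling.LinnikStubs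

open scoped _root_.NumberField nonZeroDivisors
open _root_.NumberField
open Literature.Computability.Cryptography
open Literature.Computability.Cryptography.CubicClassTable

/-- **Layout of a position.** For `E < W` and `j < 2^ℓy`, the position `v = E + W j` has exponent block `E`, grid index `j`,
digits `E / (2^ℓe)^t mod 2^ℓe` and target `t̂ = (j mod 2^s)·r·2^(prec−k−s)`.
[cite: BuchmannWilliams1988, §3 (semantics of the class-group table; supporting lemma)] -/
theorem inst_pos_decomp (I : Inst) {E j : ℕ} (hE : E < I.W) (hj : j < 2 ^ I.ℓy) :
    I.Eof (E + I.W * j) = E ∧ I.jof (E + I.W * j) = j ∧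
      (∀ t, I.digit (E + I.W * j) t = E / (2 ^ I.ℓe) ^ t % 2 ^ I.ℓe) ∧
      I.tgt (E + I.W * j) = (j % 2 ^ I.s) * I.r * 2 ^ (I.prec - I.k - I.s) := by
  have hW : 0 < I.W := lt_of_le_of_lt (Nat.zero_le E) hE
  have hEof : I.Eof (E + I.W * j) = E := by
    unfold Inst.Eof; rw [Nat.add_mul_mod_self_left, Nat.mod_eq_of_lt hE]
  have hjof : I.jof (E + I.W * j) = j := by
    unfold Inst.jof; rw [Nat.add_mul_div_left _ _ hW, Nat.div_eq_of_lt hE, zero_add, Nat.mod_eq_of_lt hj]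
  refine ⟨hEof, hjof, fun t => ?_, ?_⟩
  · unfold Inst.digit; rw [hEof]; rfl
  · unfold Inst.tgt; rw [hjof]

/-- `size (a b) ≤ size (27 a² b²)`.
[cite: BuchmannWilliams1988, §3 (semantics of the class-group table; supporting lemma)] -/
theorem size_ab_le {a b : ℕ} (ha : a ≠ 0) (hb : b ≠ 0) : Nat.size (a * b) ≤ Nat.size (27 * a ^ 2 * b ^ 2) := by
  apply Nat.size_le_size
  have h1 : 1 ≤ a * b := Nat.one_le_iff_ne_zero.mpr (mul_ne_zero ha hb)
  calc a * b = 1 * (a * b) * 1 := by ring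
    _ ≤ 27 * (a * b) * (a * b) := by nlinarith
    _ = 27 * a ^ 2 * b ^ 2 := by ring

/-- **Numeric side conditions** implied by the parameter inequalities of `ClassTableInterfaceQ3`.
[cite: BuchmannWilliams1988, §3 (semantics of the class-group table; supporting lemma)] -/
theorem inst_numerics {a b ℓe s npp e k prec sz : ℕ} (ha : a ≠ 0) (hb : b ≠ 0)
    (hk : ℓe + s + npp + 60 + 6 * Nat.size (27 * a ^ 2 * b ^ 2) + e + 2 * sz ≤ k) (hprec : k + s + npp + 64 ≤ prec) :
    4 * Nat.size (a * b) + 8 ≤ prec ∧ 9 ≤ prec ∧ 4 ≤ k ∧ k + s ≤ prec ∧ npp ≤ prec := by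
  have hsz := size_ab_le ha hb
  omega

/-- `1/16 ≤ R_K` from `log 2 / 6 ≤ R_K`.
[cite: BuchmannWilliams1988, §3 (semantics of the class-group table; supporting lemma)] -/
theorem regulator_sixteenth_le {R : ℝ} (hR6 : Real.log 2 / 6 ≤ R) : (1 : ℝ) / 16 ≤ R := by
  have := Real.log_two_gt_d9
  linarith

/-- `log 2 / 6 ≤ R` from a period bound `n₀ log 2 ≤ 6 R` with `n₀ ≥ 1`.
[cite: BuchmannWilliams1988, §3 (semantics of the class-group table; supporting lemma)] -/
theorem regulator_ge_of_period {n₀ : ℕ} (hn₀ : 0 < n₀) {R : ℝ} (h : (n₀ : ℝ) * Real.log 2 ≤ 6 * R) :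
    Real.log 2 / 6 ≤ R := by
  have h1 : (1 : ℝ) ≤ n₀ := by exact_mod_cast hn₀
  have hl := Real.log_two_gt_d9
  nlinarith

/-- `n₀ ≤ 9 d⁶` from `n₀ log 2 ≤ 6 R`, `R ≤ d⁶`.
[cite: BuchmannWilliams1988, §3 (semantics of the class-group table; supporting lemma)] -/
theorem period_le_nine_pow_six {n₀ : ℕ} {R d : ℝ} (h : (n₀ : ℝ) * Real.log 2 ≤ 6 * R) (hRd : R ≤ d ^ 6) (hd : 1 ≤ d) :
    (n₀ : ℝ) ≤ 9 * d ^ 6 := by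
  have hl := Real.log_two_gt_d9
  have hd6 : (1 : ℝ) ≤ d ^ 6 := one_le_pow₀ hd
  nlinarith

/-- `LB = log (3 √d) ≤ d⁶` for `d ≥ 2`.
[cite: BuchmannWilliams1988, §3 (semantics of the class-group table; supporting lemma)] -/
theorem logB_le_pow_six {d : ℝ} (hd : 2 ≤ d) : Real.log (3 * Real.sqrt d) ≤ d ^ 6 := by
  have hs : Real.sqrt d ≤ d := by
    rw [Real.sqrt_le_left (by linarith)]
    nlinarith
  have h1 : Real.log (3 * Real.sqrt d) ≤ 3 * Real.sqrt d - 1 := by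
    have hpos : 0 < 3 * Real.sqrt d := by positivity
    linarith [Real.log_le_sub_one_of_pos hpos]
  have hd6 : 3 * d ≤ d ^ 6 := by
    have : (3 : ℝ) ≤ d ^ 5 := by
      calc (3 : ℝ) ≤ 2 ^ 5 := by norm_num
        _ ≤ d ^ 5 := pow_le_pow_left₀ (by norm_num) hd 5
    nlinarith
  nlinarith

/-- `3/2^prec ≤ LB` for `prec ≥ 9` (`LB ≥ log 3 > 1`).
[cite: BuchmannWilliams1988, §3 (semantics of the class-group table; supporting lemma)] -/
theorem three_div_le_logB {d : ℝ} (hd : 1 ≤ d) {prec : ℕ} (hprec : 9 ≤ prec) :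
    (3 : ℝ) / 2 ^ prec ≤ Real.log (3 * Real.sqrt d) := by
  have hs : (1 : ℝ) ≤ Real.sqrt d := by rw [Real.one_le_sqrt]; exact hd
  have h3 : Real.log 3 ≤ Real.log (3 * Real.sqrt d) := Real.log_le_log (by norm_num) (by nlinarith)
  have hlog3 : 1 ≤ Real.log 3 := by
    rw [Real.le_log_iff_exp_le (by norm_num)]
    have := Real.exp_one_lt_d9
    linarith
  have h2 : (3 : ℝ) / 2 ^ prec ≤ 1 := by
    rw [div_le_one (by positivity)]
    calc (3 : ℝ) ≤ 2 ^ 9 := by norm_num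
      _ ≤ 2 ^ prec := pow_le_pow_right₀ (by norm_num) hprec
  linarith

/-- `2^prec / 16 ≤ Rint = r 2^(prec−k)` from the regulator advice `|r − 2^k R| ≤ 1`, `R ≥ log 2/6`, `k ≥ 5`, `k ≤ prec`.
[cite: BuchmannWilliams1988, §3 (semantics of the class-group table; supporting lemma)] -/
theorem Rint_ge {r k prec : ℕ} {R : ℝ} (hr : |(r : ℝ) - 2 ^ k * R| ≤ 1) (hR6 : Real.log 2 / 6 ≤ R) (hk : 5 ≤ k)
    (hkp : k ≤ prec) : (2 : ℝ) ^ prec / 16 ≤ ((r * 2 ^ (prec - k) : ℕ) : ℝ) := by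
  have hl := Real.log_two_gt_d9
  rw [abs_le] at hr
  have h32 : (32 : ℝ) ≤ 2 ^ k := by
    calc (32 : ℝ) = 2 ^ 5 := by norm_num
      _ ≤ 2 ^ k := pow_le_pow_right₀ (by norm_num) hk
  have hr16 : (2 : ℝ) ^ k / 16 ≤ r := by
    have h1 : (2 : ℝ) ^ k * R - 1 ≤ r := by linarith
    have h2 : (2 : ℝ) ^ k * (Real.log 2 / 6) ≤ 2 ^ k * R := mul_le_mul_of_nonneg_left hR6 (by positivity)
    have h3 : (2 : ℝ) ^ k / 16 ≤ 2 ^ k * (Real.log 2 / 6) - 1 := by nlinarith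
    linarith
  have e : (2 : ℝ) ^ prec = 2 ^ k * 2 ^ (prec - k) := by rw [← pow_add]; congr 1; omega
  push_cast
  rw [e]
  have h0 : (0 : ℝ) ≤ 2 ^ (prec - k) := by positivity
  calc (2 : ℝ) ^ k * 2 ^ (prec - k) / 16 = 2 ^ k / 16 * 2 ^ (prec - k) := by ring
    _ ≤ r * 2 ^ (prec - k) := mul_le_mul_of_nonneg_right hr16 h0

/-- `p ≤ cap` from `(243 a² b² (p+1))² ≤ cap` (`a, b ≥ 1`).
[cite: BuchmannWilliams1988, §3 (semantics of the class-group table; supporting lemma)] -/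
theorem prime_le_cap {a b p cap : ℕ} (ha : a ≠ 0) (hb : b ≠ 0) (h : (243 * a ^ 2 * b ^ 2 * (p + 1)) ^ 2 ≤ cap) : p ≤ cap := by
  have h1 : 1 ≤ 243 * a ^ 2 * b ^ 2 := by
    have := Nat.one_le_iff_ne_zero.mpr (mul_ne_zero ha hb)
    calc 1 ≤ a * b := this
      _ ≤ 243 * (a * b) * (a * b) := by nlinarith
      _ = 243 * a ^ 2 * b ^ 2 := by ring
  calc p ≤ p + 1 := Nat.le_succ p
    _ ≤ 243 * a ^ 2 * b ^ 2 * (p + 1) := Nat.le_mul_of_pos_left _ h1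
    _ ≤ (243 * a ^ 2 * b ^ 2 * (p + 1)) ^ 2 := Nat.le_self_pow (by norm_num) _
    _ ≤ cap := h

end Literature.Computability.Cryptography.CubicClassSampling.LinnikStubs

end Part8

/-!
## Part 9 — port of `Summits/QuantumAdvantage/QuantumAdvantage/Theorems/LinnikCubicClassGroupsPureCubicClassGroupFBQPStubSemCoords.lean` (1 declarations kept)

# `LinnikCubicClassGroups.PureCubicClassGroupFBQP` () — stub `stub_semCoords`

Declarations of this Part (verbatim port; each keeps its own docstring and citation): `stub_semCoords`.
-/

section Part9

namespace Literature.Computability.Cryptography.CubicClassSampling.LinnikStubs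

open Literature.NumberTheory.CubicFields

/-- **`stub_semCoords`**: on a periodic chain `G` (period `n₀`, `R`) with index function `idx` and `n₀`-periodic labels
`Lab`, a coordinate `u` within `(−ηd, Δ + ηd)` of the grid window `[(σ+j)Δ, (σ+j)Δ + Δ]` (`Δ = R/2^s`) whose `(η+ηd)`-enlargement
holds no breakpoint `G k + m/2^npp` is `η`-far from every breakpoint, and its cell `(Lab (idx u), ⌊(u − G (idx u)) 2^npp⌋)` is the
cell of the reduced grid point `((σ + j) mod 2^s)·Δ`. [Buchmann–Williams 1988 §3; Hallgren 2005 §4]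
[cite: BuchmannWilliams1988, §3 (semantics of the class-group table; supporting lemma)] -/
theorem stub_semCoords :
    ∀ (G : ℤ → ℝ), StrictMono G → ∀ (n₀ : ℕ), 0 < n₀ → ∀ (R : ℝ), (∀ i, G (i + n₀) = G i + R) →
    ∀ (idx : ℝ → ℤ), (∀ x, G (idx x) ≤ x ∧ x < G (idx x + 1)) →
    ∀ (Lab : ℤ → ℕ × List ℤ), (∀ i j, Lab i = Lab j ↔ (n₀ : ℤ) ∣ i - j) →
    ∀ (npp s : ℕ) (η ηd : ℝ), 0 ≤ η → 0 ≤ ηd →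
    ∀ (σ j : ℕ) (u : ℝ),
      (σ : ℝ) * (R / ((2 ^ s : ℕ) : ℝ)) + (j : ℝ) * (R / ((2 ^ s : ℕ) : ℝ)) - ηd < u →
      u < (σ : ℝ) * (R / ((2 ^ s : ℕ) : ℝ)) + (j : ℝ) * (R / ((2 ^ s : ℕ) : ℝ)) + R / ((2 ^ s : ℕ) : ℝ) + ηd →
      (∀ (k : ℤ) (m : ℕ), (m : ℝ) / (2 : ℝ) ^ npp < G (k + 1) - G k →
        ¬ ((σ : ℝ) * (R / ((2 ^ s : ℕ) : ℝ)) + (j : ℝ) * (R / ((2 ^ s : ℕ) : ℝ)) - (η + ηd) ≤ G k + m / (2 : ℝ) ^ npp ∧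
            G k + m / (2 : ℝ) ^ npp ≤
              (σ : ℝ) * (R / ((2 ^ s : ℕ) : ℝ)) + (j : ℝ) * (R / ((2 ^ s : ℕ) : ℝ)) + R / ((2 ^ s : ℕ) : ℝ) + (η + ηd))) →
      (∀ (k : ℤ) (m : ℕ), (m : ℝ) / (2 : ℝ) ^ npp < G (k + 1) - G k → η < |u - (G k + m / (2 : ℝ) ^ npp)|) ∧
      (Lab (idx u), ⌊(u - G (idx u)) * (2 : ℝ) ^ npp⌋₊) =
        (Lab (idx ((((σ + j) % 2 ^ s : ℕ) : ℝ) * (R / ((2 ^ s : ℕ) : ℝ)))),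
          ⌊(((((σ + j) % 2 ^ s : ℕ) : ℝ) * (R / ((2 ^ s : ℕ) : ℝ))) -
            G (idx ((((σ + j) % 2 ^ s : ℕ) : ℝ) * (R / ((2 ^ s : ℕ) : ℝ))))) * (2 : ℝ) ^ npp⌋₊) := by
  intro G hG n₀ hn₀ R hper idx hidx Lab hLab npp s η ηd hη hηd σ j u hu1 hu2 hfree
  have hR : 0 < R := chain_period_pos hG hn₀ hper
  have h2s : (0 : ℝ) < ((2 ^ s : ℕ) : ℝ) := by positivity
  have hΔ : (0 : ℝ) ≤ R / ((2 ^ s : ℕ) : ℝ) := (div_pos hR h2s).le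
  have hN : (0 : ℝ) < (2 : ℝ) ^ npp := by positivity
  refine ⟨?_, ?_⟩
  · -- (1) `u` is `η`-far from every breakpoint
    intro k m hgap
    have h := hfree k m hgap
    rw [lt_abs]
    by_cases hle : (σ : ℝ) * (R / ((2 ^ s : ℕ) : ℝ)) + (j : ℝ) * (R / ((2 ^ s : ℕ) : ℝ)) - (η + ηd) ≤
        G k + m / (2 : ℝ) ^ npp
    · have h' : ¬ (G k + m / (2 : ℝ) ^ npp ≤
          (σ : ℝ) * (R / ((2 ^ s : ℕ) : ℝ)) + (j : ℝ) * (R / ((2 ^ s : ℕ) : ℝ)) + R / ((2 ^ s : ℕ) : ℝ) + (η + ηd)) :=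
        fun h' => h ⟨hle, h'⟩
      have h'' := not_le.1 h'
      right; linarith
    · have h'' := not_le.1 hle
      left; linarith
  · -- (2) the cell of `u` is the cell of the reduced grid point
    -- first: `cell u = cell z`, `z = σΔ + jΔ`, by breakpoint-freeness of the interval between them
    have hcell : (Lab (idx u), ⌊(u - G (idx u)) * (2 : ℝ) ^ npp⌋₊) =
        (Lab (idx ((σ : ℝ) * (R / ((2 ^ s : ℕ) : ℝ)) + (j : ℝ) * (R / ((2 ^ s : ℕ) : ℝ)))),
          ⌊(((σ : ℝ) * (R / ((2 ^ s : ℕ) : ℝ)) + (j : ℝ) * (R / ((2 ^ s : ℕ) : ℝ))) -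
            G (idx ((σ : ℝ) * (R / ((2 ^ s : ℕ) : ℝ)) + (j : ℝ) * (R / ((2 ^ s : ℕ) : ℝ))))) * (2 : ℝ) ^ npp⌋₊) := by
      rcases le_total u ((σ : ℝ) * (R / ((2 ^ s : ℕ) : ℝ)) + (j : ℝ) * (R / ((2 ^ s : ℕ) : ℝ))) with huz | hzu
      · obtain ⟨h1, h2⟩ := chain_cell_eq_of_no_breakpoint hG hidx hN huz
          (fun k m hgap hb => hfree k m hgap ⟨by linarith [hb.1], by linarith [hb.2]⟩)
        rw [h2, h1]
      · obtain ⟨h1, h2⟩ := chain_cell_eq_of_no_breakpoint hG hidx hN hzu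
          (fun k m hgap hb => hfree k m hgap ⟨by linarith [hb.1], by linarith [hb.2]⟩)
        rw [← h2, ← h1]
    -- second: `z = ((σ+j) % 2^s)Δ + ((σ+j) / 2^s)·R`, and the cell function is `R`-periodic
    have hdm : ((2 ^ s : ℕ) : ℝ) * (((σ + j) / 2 ^ s : ℕ) : ℝ) + (((σ + j) % 2 ^ s : ℕ) : ℝ) = (σ : ℝ) + j := by
      have h := Nat.div_add_mod (σ + j) (2 ^ s)
      exact_mod_cast h
    have hΔR : ((2 ^ s : ℕ) : ℝ) * (R / ((2 ^ s : ℕ) : ℝ)) = R := by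
      field_simp
    have hzz' : (σ : ℝ) * (R / ((2 ^ s : ℕ) : ℝ)) + (j : ℝ) * (R / ((2 ^ s : ℕ) : ℝ)) =
        (((σ + j) % 2 ^ s : ℕ) : ℝ) * (R / ((2 ^ s : ℕ) : ℝ)) + ((((σ + j) / 2 ^ s : ℕ) : ℤ) : ℝ) * R := by
      have e : ((((σ + j) / 2 ^ s : ℕ) : ℤ) : ℝ) = (((σ + j) / 2 ^ s : ℕ) : ℝ) := Int.cast_natCast _
      rw [e]
      calc (σ : ℝ) * (R / ((2 ^ s : ℕ) : ℝ)) + (j : ℝ) * (R / ((2 ^ s : ℕ) : ℝ))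
          = ((σ : ℝ) + j) * (R / ((2 ^ s : ℕ) : ℝ)) := by ring
        _ = (((2 ^ s : ℕ) : ℝ) * (((σ + j) / 2 ^ s : ℕ) : ℝ) + (((σ + j) % 2 ^ s : ℕ) : ℝ)) *
              (R / ((2 ^ s : ℕ) : ℝ)) := by rw [hdm]
        _ = (((σ + j) % 2 ^ s : ℕ) : ℝ) * (R / ((2 ^ s : ℕ) : ℝ)) +
              (((σ + j) / 2 ^ s : ℕ) : ℝ) * (((2 ^ s : ℕ) : ℝ) * (R / ((2 ^ s : ℕ) : ℝ))) := by ring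
        _ = (((σ + j) % 2 ^ s : ℕ) : ℝ) * (R / ((2 ^ s : ℕ) : ℝ)) + (((σ + j) / 2 ^ s : ℕ) : ℝ) * R := by rw [hΔR]
    rw [hcell, hzz']
    exact cell_add_int_mul_period hG hn₀ hper hidx hLab _ _

end Literature.Computability.Cryptography.CubicClassSampling.LinnikStubs

end Part9

/-!
## Part 10 — port of `Summits/QuantumAdvantage/QuantumAdvantage/Theorems/LinnikCubicClassGroupsPureCubicClassGroupFBQPStubSemDrift.lean` (1 declarations kept)

# `LinnikCubicClassGroups.PureCubicClassGroupFBQP` () — stub `stub_semDrift`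

Declarations of this Part (verbatim port; each keeps its own docstring and citation): `stub_semDrift`.
-/

section Part10

namespace Literature.Computability.Cryptography.CubicClassSampling.LinnikStubs

/-- **`stub_semDrift`**: with `R̂ = r/2^k`, `|r − 2^k R| ≤ 1`, the target `t⋆ = j'·r·2^(prec−k−s) + N·r·2^(prec−k)` and
`|N − main/R̂| ≤ BN` (note `2^prec·main/(r 2^(prec−k)) = main/R̂`): `t⋆/2^prec` is `j' R/2^s + N R + ((R̂ − R)/R̂)·main` up to
`(BN + 1)/2^k`. [Hallgren 2005 §4]
[cite: BuchmannWilliams1988, §3 (semantics of the class-group table; supporting lemma)] -/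
theorem stub_semDrift :
    ∀ (prec k s r : ℕ) (R main BN : ℝ) (j' : ℕ) (N tstar : ℤ), 0 < r → k + s ≤ prec → j' < 2 ^ s →
      |(r : ℝ) - 2 ^ k * R| ≤ 1 →
      tstar = ((j' * r * 2 ^ (prec - k - s) : ℕ) : ℤ) + N * ((r * 2 ^ (prec - k) : ℕ) : ℤ) →
      |(N : ℝ) - 2 ^ prec * main / ((r * 2 ^ (prec - k) : ℕ) : ℝ)| ≤ BN →
      |(tstar : ℝ) / 2 ^ prec -
          ((j' : ℝ) * (R / ((2 ^ s : ℕ) : ℝ)) + (N : ℝ) * R + ((r : ℝ) / 2 ^ k - R) / ((r : ℝ) / 2 ^ k) * main)| ≤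
        (BN + 1) / 2 ^ k := by
  intro prec k s r R main BN j' N tstar hr hks hj hR htstar hN
  -- split the precision as `prec = m + k + s`
  obtain ⟨m, rfl⟩ : ∃ m, prec = m + k + s := ⟨prec - k - s, by omega⟩
  have h1 : m + k + s - k - s = m := by omega
  have h2 : m + k + s - k = m + s := by omega
  rw [h1, h2] at htstar
  rw [h2] at hN
  have hr' : (0 : ℝ) < r := Nat.cast_pos.mpr hr
  have hr0 : (r : ℝ) ≠ 0 := hr'.ne'
  have h2k : (0 : ℝ) < 2 ^ k := by positivity
  have h2s : (0 : ℝ) < 2 ^ s := by positivity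
  -- the target, cast to `ℝ`
  have htR : (tstar : ℝ) = (j' : ℝ) * r * 2 ^ m + (N : ℝ) * (r * 2 ^ (m + s)) := by
    have := congrArg (Int.cast : ℤ → ℝ) htstar
    push_cast at this
    linarith
  -- exact algebraic identity: the difference is `δ · (j'/2^s + (N − main/R̂))` with `δ = R̂ − R`
  have key : (tstar : ℝ) / 2 ^ (m + k + s) -
      ((j' : ℝ) * (R / ((2 ^ s : ℕ) : ℝ)) + (N : ℝ) * R + ((r : ℝ) / 2 ^ k - R) / ((r : ℝ) / 2 ^ k) * main) =
      (((r : ℝ) - 2 ^ k * R) / 2 ^ k) *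
        ((j' : ℝ) / 2 ^ s + ((N : ℝ) - 2 ^ (m + k + s) * main / ((r * 2 ^ (m + s) : ℕ) : ℝ))) := by
    rw [htR]
    push_cast
    field_simp
    ring
  rw [key, abs_mul, abs_div, abs_of_pos h2k]
  -- bound the two factors
  have hj' : (j' : ℝ) / 2 ^ s ≤ 1 := by
    rw [div_le_one h2s]
    exact_mod_cast hj.le
  have hj0 : (0 : ℝ) ≤ (j' : ℝ) / 2 ^ s := by positivity
  have hB : |(j' : ℝ) / 2 ^ s + ((N : ℝ) - 2 ^ (m + k + s) * main / ((r * 2 ^ (m + s) : ℕ) : ℝ))| ≤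
      BN + 1 := by
    refine (abs_add_le _ _).trans ?_
    rw [abs_of_nonneg hj0]
    linarith
  have hBN0 : 0 ≤ BN + 1 := (abs_nonneg _).trans hB
  calc |(r : ℝ) - 2 ^ k * R| / 2 ^ k *
        |(j' : ℝ) / 2 ^ s + ((N : ℝ) - 2 ^ (m + k + s) * main / ((r * 2 ^ (m + s) : ℕ) : ℝ))|
      ≤ 1 / 2 ^ k * (BN + 1) :=
        mul_le_mul (div_le_div_of_nonneg_right hR h2k.le) hB (abs_nonneg _) (by positivity)
    _ = (BN + 1) / 2 ^ k := by ring

end Literature.Computability.Cryptography.CubicClassSampling.LinnikStubs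

end Part10

/-!
## Part 11 — port of `Summits/QuantumAdvantage/QuantumAdvantage/Theorems/LinnikCubicClassGroupsPureCubicClassGroupFBQPStubSemCoreB.lean` (1 declarations kept)

# `LinnikCubicClassGroups.PureCubicClassGroupFBQP` () — stub `stub_semMain`, part CORE (variant B, Circle-free imports)

Declarations of this Part (verbatim port; each keeps its own docstring and citation): `table_value_eq_shiftCell`.
-/

section Part11

namespace Literature.Computability.Cryptography.CubicClassSampling.LinnikStubs

open scoped _root_.NumberField nonZeroDivisors
open _root_.NumberField
open Literature.NumberTheory.CubicFields
open Literature.NumberTheory.CubicFields.PureCubicCodes (Canon Mem)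
open Literature.NumberTheory.NumberFields.PureCubic (abs_discr_le ne_zero_of_squarefree_mul)
open Literature.Computability.Cryptography
open Literature.Computability.Cryptography.CubicClassTable
open Literature.Computability.Cryptography.CubicClassTable.WalkFns

section Core

variable {K : Type} [Field K] [NumberField K] {θ : K} {σ₁ : K →+* ℝ} {σ₂ : K →+* ℂ} {F : WalkFns} {I : Inst}
variable (hdeg : Module.finrank ℚ K = 3) (hσ₂ : ∃ z : K, starRingEnd ℂ (σ₂ z) ≠ σ₂ z)
  (ε : (𝓞 K)ˣ) (hε : 1 < σ₁ (algebraMap (𝓞 K) K ε)) (hreg : Real.log (σ₁ (algebraMap (𝓞 K) K ε)) = Units.regulator K)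
  (hab : Squarefree (I.a * I.b)) (hab1 : I.a * I.b ≠ 1) (hθ : θ ^ 3 = ((I.a * I.b ^ 2 : ℕ) : K))
  (hred : RedSem F I.a I.b K θ σ₁ σ₂) (hprod : ProdSpec I.a I.b K θ F.latProd)
  {cap : ℕ} (hcap : (243 * I.a ^ 2 * I.b ^ 2) ^ 2 ≤ cap)
  (hord : Canon I.ord) (hordm : ∀ φ : K, Mem θ I.b I.ord φ ↔ IsIntegral ℤ φ)
  (h6 : ∀ A : FractionalIdeal (𝓞 K)⁰ K, A ≠ 0 → ∀ x₀ ∈ posRelMinima σ₁ σ₂ A, ∀ i : ℤ,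
    2 * σ₁ (voronoiChain σ₁ σ₂ A x₀ i) ≤ σ₁ (voronoiChain σ₁ σ₂ A x₀ (i + 6)))
  (hR6 : Real.log 2 / 6 ≤ Units.regulator K)
  (hs₀ : I.s₀ = 18 * (10 * Nat.size (I.a * I.b) + 48)) (hTdbl : 6 * Nat.size (27 * I.a ^ 2 * I.b ^ 2) + 16 ≤ I.Tdbl)
  (hBb : 32 * (10 * Nat.size (I.a * I.b) + 48) ^ 2 ≤ I.Bb) (hmargin : I.margin = 0)
  (hr : |(I.r : ℝ) - 2 ^ I.k * Units.regulator K| ≤ 1)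
  {e sz : ℕ} (hsz : I.ps.length < 2 ^ sz)
  (hk : I.ℓe + I.s + I.npp + 60 + 6 * Nat.size (27 * I.a ^ 2 * I.b ^ 2) + e + 2 * sz ≤ I.k)
  (hkprec : I.k + I.s + I.npp + 64 ≤ I.prec) (hs : I.npp + 6 * Nat.size (27 * I.a ^ 2 * I.b ^ 2) + 50 + e ≤ I.s)
  {𝔤 : ℕ → Ideal (𝓞 K)} {γ : ℕ → K}
  (hslot : ∀ v, ∀ t < I.T, 𝔤 t ≠ ⊥ ∧ Canon (F.gT I v t) ∧
    (∀ φ : K, Mem θ I.b (F.gT I v t) φ ↔ φ ∈ (𝔤 t : FractionalIdeal (𝓞 K)⁰ K)) ∧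
    γ t ∈ (𝔤 t : FractionalIdeal (𝓞 K)⁰ K) ∧ 0 < σ₁ (γ t) ∧ ‖σ₂ (γ t)‖ < 1 ∧
    (∀ φ : K, φ ∈ (𝔤 t : FractionalIdeal (𝓞 K)⁰ K) → 0 < σ₁ φ → ‖σ₂ φ‖ < 1 → σ₁ (γ t) ≤ σ₁ φ))

include hdeg hσ₂ hε hreg hab hab1 hθ hred hprod hcap hord hordm h6 hR6 hs₀ hTdbl hBb hmargin hr hsz hk hkprec hs hslot in
set_option maxHeartbeats 800000 in
/-- **One table value is the shift-cell value** (see the module docstring; the composition is long, hence the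
heartbeat budget). [cite: BuchmannWilliams1988, §3 (semantics of the class-group table; supporting lemma)] -/
theorem table_value_eq_shiftCell {E j : ℕ} (hE : E < I.W) (hj : j < 2 ^ I.ℓy)
    {Ag : FractionalIdeal (𝓞 K)⁰ K} {αE : K} (hαE : 0 < σ₁ αE)
    (hAE : ∏ t ∈ Finset.range I.T, ((𝔤 t : Ideal (𝓞 K)) : FractionalIdeal (𝓞 K)⁰ K) ^ (E / (2 ^ I.ℓe) ^ t % 2 ^ I.ℓe) =
      FractionalIdeal.spanSingleton (𝓞 K)⁰ αE * Ag)
    {x₀ : K} (hx₀ : x₀ ∈ posRelMinima σ₁ σ₂ Ag) {n₀ : ℕ} (hn₀ : 0 < n₀)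
    (hper : ∀ i, Real.log (σ₁ (voronoiChain σ₁ σ₂ Ag x₀ (i + n₀))) =
      Real.log (σ₁ (voronoiChain σ₁ σ₂ Ag x₀ i)) + Units.regulator K)
    {idx : ℝ → ℤ} (hidx : ∀ x, Real.log (σ₁ (voronoiChain σ₁ σ₂ Ag x₀ (idx x))) ≤ x ∧
      x < Real.log (σ₁ (voronoiChain σ₁ σ₂ Ag x₀ (idx x + 1))))
    {Lab : ℤ → ℕ × List ℤ} (hLab : ∀ i, Canon (Lab i) ∧ ∀ φ : K, Mem θ I.b (Lab i) φ ↔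
      φ ∈ FractionalIdeal.spanSingleton (𝓞 K)⁰ (voronoiChain σ₁ σ₂ Ag x₀ i)⁻¹ * Ag)
    (hLabper : ∀ i j, Lab i = Lab j ↔ (n₀ : ℤ) ∣ i - j)
    {yE : ℝ} {σE : ℕ} (hσE : (σE : ℝ) ≤ yE ∧ yE < σE + 1)
    (hyE : ∃ q : ℤ, yE * (Units.regulator K / ((2 ^ I.s : ℕ) : ℝ)) =
      (-Real.log (σ₁ αE) + ((I.r : ℝ) / 2 ^ I.k - Units.regulator K) / ((I.r : ℝ) / 2 ^ I.k) *
        ∑ t ∈ Finset.range I.T, ((E / (2 ^ I.ℓe) ^ t % 2 ^ I.ℓe : ℕ) : ℝ) * Real.log (σ₁ (γ t))) +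
        q * Units.regulator K)
    (hgood : ∀ (k : ℤ) (m : ℕ), (m : ℝ) / (2 : ℝ) ^ I.npp <
        Real.log (σ₁ (voronoiChain σ₁ σ₂ Ag x₀ (k + 1))) - Real.log (σ₁ (voronoiChain σ₁ σ₂ Ag x₀ k)) →
      ¬ ((σE : ℝ) * (Units.regulator K / ((2 ^ I.s : ℕ) : ℝ)) + (j : ℝ) * (Units.regulator K / ((2 ^ I.s : ℕ) : ℝ)) -
            (Units.regulator K / 2 ^ (I.s + 3) + Units.regulator K / 2 ^ (I.s + 3)) ≤
            Real.log (σ₁ (voronoiChain σ₁ σ₂ Ag x₀ k)) + m / (2 : ℝ) ^ I.npp ∧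
          Real.log (σ₁ (voronoiChain σ₁ σ₂ Ag x₀ k)) + m / (2 : ℝ) ^ I.npp ≤
            (σE : ℝ) * (Units.regulator K / ((2 ^ I.s : ℕ) : ℝ)) + (j : ℝ) * (Units.regulator K / ((2 ^ I.s : ℕ) : ℝ)) +
              Units.regulator K / ((2 ^ I.s : ℕ) : ℝ) +
              (Units.regulator K / 2 ^ (I.s + 3) + Units.regulator K / 2 ^ (I.s + 3)))) :
    F.classTableOpQ I cap (E + I.W * j) =
      (Lab (idx ((((σE + j) % 2 ^ I.s : ℕ) : ℝ) * (Units.regulator K / ((2 ^ I.s : ℕ) : ℝ)))),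
        ⌊(((((σE + j) % 2 ^ I.s : ℕ) : ℝ) * (Units.regulator K / ((2 ^ I.s : ℕ) : ℝ))) -
          Real.log (σ₁ (voronoiChain σ₁ σ₂ Ag x₀
            (idx ((((σE + j) % 2 ^ I.s : ℕ) : ℝ) * (Units.regulator K / ((2 ^ I.s : ℕ) : ℝ))))))) *
          (2 : ℝ) ^ I.npp⌋₊) := by
  classical
  -- ### basic numerics of the instance
  obtain ⟨ha, hb⟩ := ne_zero_of_squarefree_mul hab
  obtain ⟨hprec, h9, hk4, hks, hnpp⟩ := inst_numerics (npp := I.npp) ha hb hk hkprec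
  have hLD' : Nat.size (I.a * I.b) ≤ Nat.size (27 * I.a ^ 2 * I.b ^ 2) := size_ab_le ha hb
  have hR16 : (1 : ℝ) / 16 ≤ Units.regulator K := regulator_sixteenth_le hR6
  have hRpos : 0 < Units.regulator K := lt_of_lt_of_le (by norm_num) hR16
  obtain ⟨hLBKN, -, -, hd0⟩ := walk_consts (I := I) hdeg hab hab1 hθ hprec
  obtain ⟨hLB0, -⟩ := logB_bounds (K := K)
  obtain ⟨hr0, hRint0, -⟩ := walk_Rint (I := I) hR6 hr hk4 hks
  have hd1 : (1 : ℝ) ≤ |(discr K : ℝ)| := by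
    rw [← Int.cast_abs]; exact_mod_cast Int.one_le_abs (discr_ne_zero K)
  -- ### the layout of the position
  obtain ⟨-, -, hdig, htgt⟩ := inst_pos_decomp I hE hj
  -- ### the walk
  obtain ⟨β, N, n, hβ, hcn, hmn, hnmax, hpos, hρ, hlt, hl, hN, hNb⟩ :=
    walk_package hdeg hσ₂ ε hε hab hab1 hθ hred hprod hcap hprec hord hordm h6 hR6 hs₀ hTdbl hBb hmargin hr hk4 hks
      (E + I.W * j) 𝔤 γ (hslot (E + I.W * j))
  -- abbreviations (after the walk, so that its conclusions are abstracted too)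
  set v : ℕ := E + I.W * j with hv
  set R : ℝ := Units.regulator K with hRdef
  set S2 : ℝ := ((2 ^ I.s : ℕ) : ℝ) with hS2
  set LD : ℕ := Nat.size (27 * I.a ^ 2 * I.b ^ 2) with hLD
  set LB : ℝ := Real.log (3 * Real.sqrt |(discr K : ℝ)|) with hLB
  set Sd : ℝ := ∑ t ∈ Finset.range I.T, (I.digit v t : ℝ) with hSd
  set main : ℝ := ∑ t ∈ Finset.range I.T, (I.digit v t : ℝ) * Real.log (σ₁ (γ t)) with hmain
  set cδ : ℝ := ((I.r : ℝ) / 2 ^ I.k - R) / ((I.r : ℝ) / 2 ^ I.k) with hcδ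
  set ηd : ℝ := R / 2 ^ (I.s + 3) with hηd
  have hS2pos : 0 < S2 := by rw [hS2]; positivity
  have hS2e : S2 = (2 : ℝ) ^ I.s := by rw [hS2]; push_cast; ring
  have hΔpos : 0 < R / S2 := div_pos hRpos hS2pos
  have hRS2 : S2 * (R / S2) = R := mul_div_cancel₀ _ hS2pos.ne'
  have hηdpos : 0 < ηd := by rw [hηd]; positivity
  -- the ideal of the block in class form
  have hprodE : ∏ t ∈ Finset.range I.T, ((𝔤 t : Ideal (𝓞 K)) : FractionalIdeal (𝓞 K)⁰ K) ^ I.digit v t =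
      FractionalIdeal.spanSingleton (𝓞 K)⁰ αE * Ag := by
    rw [← hAE]; exact Finset.prod_congr rfl fun t _ => by rw [hdig t]
  rw [hprodE] at hβ hmn hl
  have hmainE : main = ∑ t ∈ Finset.range I.T, ((E / (2 ^ I.ℓe) ^ t % 2 ^ I.ℓe : ℕ) : ℝ) * Real.log (σ₁ (γ t)) := by
    rw [hmain]; exact Finset.sum_congr rfl fun t _ => by rw [hdig t]
  have hSd0 : 0 ≤ Sd := by rw [hSd]; exact Finset.sum_nonneg fun t _ => by positivity
  have hSdle : Sd ≤ ((3 * I.ps.length : ℕ) : ℝ) * 2 ^ I.ℓe := by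
    have hdlt : ∀ t ∈ Finset.range I.T, (I.digit v t : ℝ) ≤ 2 ^ I.ℓe := by
      intro t _
      have : I.digit v t < 2 ^ I.ℓe := by unfold Inst.digit Inst.M; exact Nat.mod_lt _ (by positivity)
      exact_mod_cast this.le
    calc Sd ≤ ∑ _t ∈ Finset.range I.T, (2 : ℝ) ^ I.ℓe := Finset.sum_le_sum hdlt
      _ = ((3 * I.ps.length : ℕ) : ℝ) * 2 ^ I.ℓe := by
          rw [Finset.sum_const, Finset.card_range, nsmul_eq_mul]; rfl
  -- ### the drift of the target: `t⋆/2^prec = j'Δ + N R + cδ·main + err`, `|err| ≤ ηd`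
  set BN : ℝ := 2 + (3 * Sd + 2 ^ I.prec * (2 * LB) * Sd) / I.Rint with hBN
  have hN' : F.tstarc I cap v = ((j % 2 ^ I.s * I.r * 2 ^ (I.prec - I.k - I.s) : ℕ) : ℤ) +
      N * ((I.r * 2 ^ (I.prec - I.k) : ℕ) : ℤ) := by rw [← htgt]; exact hN
  have hjmod : j % 2 ^ I.s < 2 ^ I.s := Nat.mod_lt _ (by positivity)
  have hdrift := stub_semDrift I.prec I.k I.s I.r R main BN (j % 2 ^ I.s) N (F.tstarc I cap v) hr0 hks hjmod hr hN' hNb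
  rw [← hS2] at hdrift
  have hLB3 : 3 / 2 ^ I.prec ≤ LB := three_div_le_logB hd1 h9
  have hRintge : (2 : ℝ) ^ I.prec / 16 ≤ (I.Rint : ℝ) := Rint_ge hr hR6 (by omega) (by omega)
  have hBNle : BN ≤ 2 + 48 * (((3 * I.ps.length : ℕ) : ℝ) * 2 ^ I.ℓe) * LB := num_BN hSd0 hSdle hLB3 hRintge
  have hLB2 : LB ≤ 2 ^ (LD + 6) :=
    (by linarith : LB ≤ ((10 * Nat.size (I.a * I.b) + 48 : ℕ) : ℝ)).trans (num_KN_le hLD')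
  have hetaerr := num_etaerr_halved (ℓe := I.ℓe) (s := I.s) (npp := I.npp) (LD := LD) (e := e) (sz := sz) (k := I.k)
    (np := I.ps.length) hR16 hsz hLB0 hLB2 hk
  have herr : (BN + 1) / 2 ^ I.k ≤ ηd / 2 := by
    rw [hηd]
    have h2 : (BN + 1) / 2 ^ I.k ≤ 1 / 2 ^ I.k * (1 + (2 + 48 * (((3 * I.ps.length : ℕ) : ℝ) * 2 ^ I.ℓe) * LB)) := by
      rw [one_div, inv_mul_eq_div]
      apply div_le_div_of_nonneg_right _ (by positivity)
      linarith
    have h3 : R / 2 ^ (I.s + 4) = R / 2 ^ (I.s + 3) / 2 := by rw [pow_succ]; ring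
    rw [← h3]
    exact h2.trans hetaerr
  set err : ℝ := (F.tstarc I cap v : ℝ) / 2 ^ I.prec -
    (((j % 2 ^ I.s : ℕ) : ℝ) * (R / S2) + (N : ℝ) * R + cδ * main) with herrdef
  have herrb : |err| ≤ ηd / 2 := hdrift.trans herr
  -- ### the shift congruence and the lap count
  obtain ⟨qE, hqE⟩ := hyE
  rw [← hmainE] at hqE
  try rw [← hS2] at hqE
  -- `j = 2^s (j / 2^s) + j % 2^s`
  have hjdec : (j : ℝ) * (R / S2) = ((j / 2 ^ I.s : ℕ) : ℝ) * R + ((j % 2 ^ I.s : ℕ) : ℝ) * (R / S2) := by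
    have h := Nat.div_add_mod j (2 ^ I.s)
    have h' : (j : ℝ) = S2 * ((j / 2 ^ I.s : ℕ) : ℝ) + ((j % 2 ^ I.s : ℕ) : ℝ) := by
      rw [hS2]; exact_mod_cast h.symm
    rw [h', add_mul, mul_comm S2, mul_assoc, hRS2]
  set Q : ℤ := N - qE - ((j / 2 ^ I.s : ℕ) : ℤ) with hQ
  -- the positive generator absorbing the laps
  set u₀ : K := algebraMap (𝓞 K) K ε with hu₀
  have hu₀pos : 0 < σ₁ u₀ := by rw [hu₀]; linarith
  set α' : K := αE * u₀ ^ Q with hα'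
  have hα'pos : 0 < σ₁ α' := by rw [hα', map_mul, map_zpow₀]; exact mul_pos hαE (zpow_pos hu₀pos Q)
  have hlogα' : Real.log (σ₁ α') = Real.log (σ₁ αE) + Q * R := by
    rw [hα', map_mul, map_zpow₀, Real.log_mul hαE.ne' (zpow_pos hu₀pos Q).ne', Real.log_zpow, ← hreg]
  have hideal : FractionalIdeal.spanSingleton (𝓞 K)⁰ α' * Ag = FractionalIdeal.spanSingleton (𝓞 K)⁰ αE * Ag := by
    have hcoe : u₀ ^ Q = algebraMap (𝓞 K) K ((ε ^ Q : (𝓞 K)ˣ) : 𝓞 K) := by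
      rw [hu₀]; exact (NumberField.Units.coe_zpow ε Q).symm
    rw [hα', hcoe, ← FractionalIdeal.spanSingleton_mul_spanSingleton, mul_assoc, spanSingleton_unit_mul]
  -- the target coordinate in the coordinates of the class circle
  set uu : ℝ := (F.tstarc I cap v : ℝ) / 2 ^ I.prec - Real.log (σ₁ α') with huu
  have huu_eq : uu = (σE : ℝ) * (R / S2) + (j : ℝ) * (R / S2) + ((yE - σE) * (R / S2) + err) := by
    have e1 : (F.tstarc I cap v : ℝ) / 2 ^ I.prec = err + (((j % 2 ^ I.s : ℕ) : ℝ) * (R / S2) + (N : ℝ) * R + cδ * main) := by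
      rw [herrdef]; ring
    have e2 : cδ * main = yE * (R / S2) - qE * R + Real.log (σ₁ αE) := by linarith [hqE]
    have e3 : ((Q : ℤ) : ℝ) = (N : ℝ) - qE - ((j / 2 ^ I.s : ℕ) : ℝ) := by
      simp only [hQ, Int.cast_sub, Int.cast_natCast]
    rw [huu, hlogα', e1, e2, e3, hjdec]; ring
  have hwin1 : (σE : ℝ) * (R / S2) + (j : ℝ) * (R / S2) - ηd < uu := by
    rw [huu_eq]
    have h1 : 0 ≤ (yE - σE) * (R / S2) := mul_nonneg (by linarith [hσE.1]) hΔpos.le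
    have h2 : -(ηd / 2) ≤ err := (abs_le.mp herrb).1
    linarith
  have hwin2 : uu < (σE : ℝ) * (R / S2) + (j : ℝ) * (R / S2) + R / S2 + ηd := by
    rw [huu_eq]
    have h1 : (yE - σE) * (R / S2) < R / S2 := by
      have : (yE - σE) < 1 := by linarith [hσE.2]
      calc (yE - σE) * (R / S2) < 1 * (R / S2) := mul_lt_mul_of_pos_right this hΔpos
        _ = R / S2 := one_mul _
    have h2 : err ≤ ηd / 2 := (abs_le.mp herrb).2
    linarith
  -- ### the circle and the coordinate lemma
  have hmemc := fun i => voronoiChain_mem hdeg hσ₂ ε hε hx₀ i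
  have hposc : ∀ i, 0 < σ₁ (voronoiChain σ₁ σ₂ Ag x₀ i) := fun i => (hmemc i).2
  set G : ℤ → ℝ := fun i => Real.log (σ₁ (voronoiChain σ₁ σ₂ Ag x₀ i)) with hG
  have hGm : StrictMono G := fun i i' hii' =>
    Real.log_lt_log (hposc i) (voronoiChain_strictMono hdeg hσ₂ ε hε hx₀ hii')
  have hηd0 : 0 ≤ ηd := hηdpos.le
  obtain ⟨hfar, hcell⟩ := stub_semCoords G hGm n₀ hn₀ R hper idx hidx Lab hLabper I.npp I.s ηd ηd hηd0 hηd0 σE j uu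
    hwin1 hwin2 hgood
  -- ### the tolerance `η = R/2^(s+3)` absorbs the position error of the walk
  have hηle : (3 * Sd + 3 * (((6 * LD + 9 : ℕ) : ℝ) + 1) * (2 ^ (6 * LD + 9) * ((I.s₀ : ℝ) + 1)) + n + 2) / 2 ^ I.prec ≤
      ηd := by
    have hnum := num_eta (ℓe := I.ℓe) (s := I.s) (npp := I.npp) (LD := LD) (e := e) (sz := sz) (k := I.k)
      (prec := I.prec) (np := I.ps.length) (sab := Nat.size (I.a * I.b)) hR16 hsz hLD' hk hkprec hs
    rw [hηd]
    refine le_trans ?_ hnum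
    apply div_le_div_of_nonneg_right _ (by positivity)
    rw [hs₀]
    push_cast at hSdle hnmax ⊢
    linarith [hSdle, hnmax]
  -- ### matching the stopping cell
  have hβ' : β ∈ posRelMinima σ₁ σ₂ (FractionalIdeal.spanSingleton (𝓞 K)⁰ α' * Ag) := by rw [hideal]; exact hβ
  have hmn' : ∀ φ : K, Mem θ I.b (F.cfinq I cap v).1 φ ↔
      φ ∈ FractionalIdeal.spanSingleton (𝓞 K)⁰ β⁻¹ * (FractionalIdeal.spanSingleton (𝓞 K)⁰ α' * Ag) := by
    rw [hideal]; exact hmn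
  have hl' : |((F.redc I cap (F.cfinq I cap v).1).2 : ℝ) - 2 ^ I.prec *
      (Real.log (σ₁ (voronoiSucc σ₁ σ₂ (FractionalIdeal.spanSingleton (𝓞 K)⁰ α' * Ag) β)) - Real.log (σ₁ β))| ≤ 1 := by
    rw [hideal]; exact hl
  have hε0 : 0 ≤ 3 * Sd + 3 * (((6 * LD + 9 : ℕ) : ℝ) + 1) * (2 ^ (6 * LD + 9) * ((I.s₀ : ℝ) + 1)) + n := by positivity
  have hmatch := semTable_value_eq_cellB hdeg hσ₂ ε hε hab hab1 hθ hx₀ hLab hidx hα'pos hβ' hcn hmn' hnpp hε0 hpos hρ hlt hl'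
    hηle hfar
  -- ### conclusion
  have htab : F.classTableOpQ I cap v =
      ((F.cfinq I cap v).1, ((F.tstarc I cap v - (F.cfinq I cap v).2).toNat / 2 ^ (I.prec - I.npp) : ℕ)) := rfl
  obtain ⟨hm1, hm2, -⟩ := hmatch
  rw [htab, hm1, hm2]
  exact hcell

end Core

end Literature.Computability.Cryptography.CubicClassSampling.LinnikStubs

end Part11

/-!
## Part 12 — port of `Summits/QuantumAdvantage/QuantumAdvantage/Theorems/LinnikCubicClassGroupsPureCubicClassGroupFBQPStubPacking.lean` (7 declarations kept)

# `LinnikCubicClassGroups.PureCubicClassGroupFBQP` ()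

Declarations of this Part (verbatim port; each keeps its own docstring and citation): `stub_packing_norm_le_norm_sub`, `stub_packing_two_mul_re_le`, `stub_packing_re_mul_conj`, `stub_packing_half_lt_cos`, `stub_packing_lt_two_mul_re`, `stub_packing_sector_mem`, `stub_packing`.
-/

section Part12

namespace Literature.Computability.Cryptography.CubicClassSampling.LinnikStubs

open scoped _root_.NumberField _root_.Real ComplexConjugate
open _root_.Complex

/-- (a) Two distinct relative minima `θ ≠ θ'` of `L` with real conjugates in the same dyadic range
`[t, 2t)`: the difference `θ - θ'` is a nonzero lattice vector with `|σ₁ (θ - θ')| < t ≤ |σ₁ θ|`, so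
minimality of `θ` forces `‖σ₂ θ‖ ≤ ‖σ₂ θ - σ₂ θ'‖`.
[cite: BuchmannWilliams1988, §3 (semantics of the class-group table; supporting lemma)] -/
theorem stub_packing_norm_le_norm_sub {K : Type} [Field K] (σ₁ : K →+* ℝ) (σ₂ : K →+* ℂ)
    (L : AddSubgroup K) (t : ℝ) {θ θ' : K} (hθL : θ ∈ L)
    (hmin : ∀ φ ∈ L, φ ≠ 0 → |σ₁ φ| < |σ₁ θ| → ‖σ₂ θ‖ ≤ ‖σ₂ φ‖)
    (ht : t ≤ σ₁ θ) (ht2 : σ₁ θ < 2 * t) (hθ'L : θ' ∈ L) (ht' : t ≤ σ₁ θ') (ht2' : σ₁ θ' < 2 * t)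
    (hne : θ ≠ θ') : ‖σ₂ θ‖ ≤ ‖σ₂ θ - σ₂ θ'‖ := by
  rw [← map_sub]
  refine hmin _ (L.sub_mem hθL hθ'L) (sub_ne_zero.mpr hne) ?_
  rw [map_sub, abs_sub_lt_iff]
  have : t ≤ |σ₁ θ| := ht.trans (le_abs_self _)
  constructor <;> linarith

/-- (b) Two complex numbers each no longer than their difference make an angle `≥ 60°` at `0`:
`2 re (z * conj z') ≤ ‖z‖ ‖z'‖`.
[cite: BuchmannWilliams1988, §3 (semantics of the class-group table; supporting lemma)] -/
theorem stub_packing_two_mul_re_le {z z' : ℂ} (h : ‖z‖ ≤ ‖z - z'‖) (h' : ‖z'‖ ≤ ‖z - z'‖) :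
    2 * (z * conj z').re ≤ ‖z‖ * ‖z'‖ := by
  have e := Complex.normSq_sub z z'
  simp only [Complex.normSq_eq_norm_sq] at e
  have h1 : ‖z‖ ^ 2 ≤ ‖z - z'‖ ^ 2 := pow_le_pow_left₀ (norm_nonneg _) h 2
  have h2 : ‖z'‖ ^ 2 ≤ ‖z - z'‖ ^ 2 := pow_le_pow_left₀ (norm_nonneg _) h' 2
  have hz := norm_nonneg z
  have hz' := norm_nonneg z'
  rcases le_total ‖z‖ ‖z'‖ with hle | hle
  · nlinarith [mul_le_mul_of_nonneg_left hle hz]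
  · nlinarith [mul_le_mul_of_nonneg_left hle hz']

/-- The cosine form of the real part of `z * conj z'`:
`re (z * conj z') = ‖z‖ ‖z'‖ cos (arg z - arg z')`.
[cite: BuchmannWilliams1988, §3 (semantics of the class-group table; supporting lemma)] -/
theorem stub_packing_re_mul_conj (z z' : ℂ) :
    (z * conj z').re = ‖z‖ * ‖z'‖ * Real.cos (arg z - arg z') := by
  rw [Real.cos_sub, Complex.mul_re, Complex.conj_re, Complex.conj_im]
  linear_combination (-z'.re) * Complex.norm_mul_cos_arg z
    + (-(‖z‖ * Real.cos (arg z))) * Complex.norm_mul_cos_arg z'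
    + (-z'.im) * Complex.norm_mul_sin_arg z
    + (-(‖z‖ * Real.sin (arg z))) * Complex.norm_mul_sin_arg z'

/-- Two angles with the same sector index `⌈3 a / π⌉` differ by less than `π / 3`, so the cosine of
their difference exceeds `1 / 2`.
[cite: BuchmannWilliams1988, §3 (semantics of the class-group table; supporting lemma)] -/
theorem stub_packing_half_lt_cos {a a' : ℝ} (h : ⌈3 * a / π⌉ = ⌈3 * a' / π⌉) :
    1 / 2 < Real.cos (a - a') := by
  have hπ := Real.pi_pos
  have h1 := Int.le_ceil (3 * a / π)
  have h2 := Int.ceil_lt_add_one (3 * a / π)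
  have h3 := Int.le_ceil (3 * a' / π)
  have h4 := Int.ceil_lt_add_one (3 * a' / π)
  rw [h] at h1 h2
  have e1 : (a - a') / (π / 3) = 3 * a / π - 3 * a' / π := by ring
  have e2 : (a' - a) / (π / 3) = 3 * a' / π - 3 * a / π := by ring
  have hd : |a - a'| < π / 3 := abs_sub_lt_iff.mpr
    ⟨(div_lt_one (by positivity)).mp (by rw [e1]; linarith),
     (div_lt_one (by positivity)).mp (by rw [e2]; linarith)⟩
  have hc := Real.cos_lt_cos_of_nonneg_of_le_pi (abs_nonneg (a - a')) (by linarith) hd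
  rwa [Real.cos_pi_div_three, Real.cos_abs] at hc

/-- (c) Two nonzero complex numbers with the same sector index `⌈3 arg / π⌉` make an angle `< 60°`
at `0`: `‖z‖ ‖z'‖ < 2 re (z * conj z')`.
[cite: BuchmannWilliams1988, §3 (semantics of the class-group table; supporting lemma)] -/
theorem stub_packing_lt_two_mul_re {z z' : ℂ} (hz : z ≠ 0) (hz' : z' ≠ 0)
    (h : ⌈3 * arg z / π⌉ = ⌈3 * arg z' / π⌉) : ‖z‖ * ‖z'‖ < 2 * (z * conj z').re := by
  rw [stub_packing_re_mul_conj]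
  have hc := stub_packing_half_lt_cos h
  have hp : 0 < ‖z‖ * ‖z'‖ := mul_pos (norm_pos_iff.mpr hz) (norm_pos_iff.mpr hz')
  have := mul_lt_mul_of_pos_left hc hp
  linarith

/-- The sector index `⌈3 arg z / π⌉` lies in `{-2, …, 3}`, as `arg z ∈ (-π, π]`.
[cite: BuchmannWilliams1988, §3 (semantics of the class-group table; supporting lemma)] -/
theorem stub_packing_sector_mem (z : ℂ) : -2 ≤ ⌈3 * arg z / π⌉ ∧ ⌈3 * arg z / π⌉ ≤ 3 := by
  have hπ := Real.pi_pos
  have h1 := Complex.neg_pi_lt_arg z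
  have h2 := Complex.arg_le_pi z
  constructor
  · have : (-3 : ℤ) < ⌈3 * arg z / π⌉ := by
      rw [Int.lt_ceil]
      push_cast
      rw [lt_div_iff₀ hπ]
      linarith
    omega
  · rw [Int.ceil_le]
    push_cast
    rw [div_le_iff₀ hπ]
    linarith

/-- **S1 `stub_packing`** — packing of relative minima in a dyadic range. For ANY field `K` with
ring homomorphisms `σ₁ : K → ℝ`, `σ₂ : K → ℂ`, any additive subgroup `L ⊆ K` and any `t > 0`: at
most SIX elements `θ ∈ L ∖ 0` that are relative minima of `L` (no nonzero `φ ∈ L` has both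
`|σ₁ φ| < |σ₁ θ|` and `‖σ₂ φ‖ < ‖σ₂ θ‖`) have real conjugate in the dyadic range `t ≤ σ₁ θ < 2t`.
Proof: two such minima `θ ≠ θ'` have `‖σ₂ θ - σ₂ θ'‖ ≥ max (‖σ₂ θ‖, ‖σ₂ θ'‖)` (a), hence make an
angle `≥ 60°` at `0` (b), hence have different sector indices `⌈3 arg (σ₂ ·) / π⌉ ∈ {-2, …, 3}` (c);
an injection into a six-element set bounds `encard` by `6`.
[cite: BuchmannWilliams1988, §3 (semantics of the class-group table; supporting lemma)] -/
theorem stub_packing : ∀ (K : Type) [Field K] (σ₁ : K →+* ℝ) (σ₂ : K →+* ℂ) (L : AddSubgroup K) (t : ℝ),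
    0 < t → Set.encard {θ : K | θ ∈ L ∧ θ ≠ 0 ∧
      (∀ φ ∈ L, φ ≠ 0 → |σ₁ φ| < |σ₁ θ| → ‖σ₂ θ‖ ≤ ‖σ₂ φ‖) ∧ t ≤ σ₁ θ ∧ σ₁ θ < 2 * t} ≤ 6 := by
  intro K _ σ₁ σ₂ L t _
  refine (Set.encard_le_encard_of_injOn (f := fun θ : K => ⌈3 * arg (σ₂ θ) / π⌉)
    (t := ((Finset.Icc (-2 : ℤ) 3 : Finset ℤ) : Set ℤ)) ?_ ?_).trans ?_
  · intro θ _
    simpa only [Finset.coe_Icc, Set.mem_Icc] using stub_packing_sector_mem (σ₂ θ)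
  · rintro θ ⟨hθL, hθ0, hmin, ht, ht2⟩ θ' ⟨hθ'L, hθ'0, hmin', ht', ht2'⟩ h
    by_contra hne
    have ha := stub_packing_norm_le_norm_sub σ₁ σ₂ L t hθL hmin ht ht2 hθ'L ht' ht2' hne
    have ha' := stub_packing_norm_le_norm_sub σ₁ σ₂ L t hθ'L hmin' ht' ht2' hθL ht ht2 (Ne.symm hne)
    rw [norm_sub_rev] at ha'
    have hb := stub_packing_two_mul_re_le ha ha'
    have hc := stub_packing_lt_two_mul_re ((map_ne_zero σ₂).mpr hθ0) ((map_ne_zero σ₂).mpr hθ'0) h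
    linarith
  · rw [Set.encard_coe_eq_coe_finsetCard, Int.card_Icc]
    norm_num

end Literature.Computability.Cryptography.CubicClassSampling.LinnikStubs

end Part12

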